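import Literature.Algebra.Polynomial.LacunaryBivariateOnLine
import HarnessLib

/-!
# Bihan–El Hilany 2017: the sharp bound `6t − 7` for a sparse plane curve and a line

F. Bihan, B. El Hilany, *A sharp bound on the number of real intersection points of a sparse plane
curve with a line*, J. Symbolic Comput. **81** (2017) 88–96, doi:10.1016/j.jsc.2016.12.003,
arXiv:1506.03309 [BihanElhilany2017] (held text `paper:arxiv-1506.03309`, 3000-character chunks
`p0001`–`p0009` of the arXiv source: §2 = `p0004`, §3 = `p0005`–`p0006`; `pNNNN Lnn` below = chunk
and line of the held text). A theorem-only sequel (no named facts, no definitions) to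
`Literature.Algebra.Polynomial.LacunaryBivariateOnLine` (Avendaño 2009, the bound `6t − 4`): it
PROVES the two equality-case results of §2, the invariance of `V` under `x ↦ 1/x`, and the main
Theorem 1 (`6t − 7`, §3) — WITH THE BINDER `t ≥ 3` THAT THE PRINTED STATEMENT OMITS AND NEEDS
(`BihanElHilany2017.thm_1_asPrinted_counterexample`: the printed bound fails for `t = 2`) — in
the parent's vocabulary: ONE notion of `V`, Mathlib's `Polynomial.signVariations`; `f ∈ K[x][y]`
is `Polynomial (Polynomial K)` with `y`-coefficients `aⱼ = f.coeff j ∈ K[x]`;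
`f(x, x+1) = f.eval (X + C 1)`; the number of non-zero terms is `t = Σ_{j ∈ supp_y f} #supp(aⱼ)`;
in §3 the terms are an indexed family `cᵢ x^{αᵢ} y^{βᵢ}` (`i ∈ ι`) with `cᵢ ≠ 0` and distinct
exponent pairs, `t = #ι`.

## Dictionary (source item → Lean → status)

* §3, "`V(g) = V(g₁)`" for `g₁(x) = x^d g(1/x)` (p0005 L110, p0006 L7) → `signVariations_reverse`
  (`V(reverse P) = V(P)`, any linearly ordered semiring: the sign sequence of the reversal is the
  reversed sign sequence, and the number of sign blocks is reversal invariant) and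
  `signVariations_reflect` (`V(reflect N P) = V(P)` for `N ≥ deg P`) — proved (private helpers:
  `deg (reflect N f) = N − trailing(f)`, `#supp (reflect N f) = #supp f`).
* Lemma 3 "[A]" (p0004 L8) = Avendaño's Lemma 5 → the parent's `signVariations_X_add_C_mul_le`;
  Lemma 4 "[A]" (p0004 L13) = Avendaño's Remark 6 →
  `signVariations_add_le_add_two_mul_card_support`;
  Prop. 6 "[A]" (p0004 L37) = Avendaño's Prop. 7 → `Avendano2009_prop_7` — CITED, not restated.
* **Lemma 5** (p0004 L18–35) → `BihanElHilany2017_lemma_5` — proved. TYPED vs PRINTED: "`g` has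
  `t` terms" is `t = g.support.card` with `g ≠ 0` an explicit binder (for `g = 0` the printed
  "`𝒩(g) ⊂ 𝒩°(f)`" has no content); for univariate `f, g` the inclusion "`𝒩(g) ⊂ 𝒩°(f)`" is
  typed as `trailing(f) < trailing(g) ∧ deg g < deg f` (`natTrailingDegree`, `natDegree`); the
  printed "symmetric case `α_s ≤ β_t`" is the reflected case (`signVariations_reflect`); the
  one-step bound of the printed proof, `V(f + g) ≤ V(f) + 2t − 1` when `β₁ ≤ α₁`, is
  `signVariations_add_lt_of_natDegree_le` (stated at the top end). Any linearly ordered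
  commutative ring (the paper: `ℝ`).
* **Prop. 7** (p0004 L62–92) → `BihanElHilany2017_prop_7`, with the Newton-polytope conclusion
  of its proof (display (5)) as `BihanElHilany2017_prop_7_shape` / `_newtonPolytope` — proved by
  the parent's Horner recursion `f(x, p) = p·(divX f)(x, p) + a₀(x)` (the printed `f_k`), every
  inequality of Avendaño's proof being forced to an equality (the printed (3)). TYPED vs PRINTED:
  the printed conclusion is a statement about the point configuration
  `{(β_i, γ_i)}` ordered by `γ`; ours is its coefficient-support reading — the top
  `y`-coefficient `a_n` (`n = deg_y f = γ_t`) is a single monomial `b_t x^{β_t}`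
  (`a_n.support.card = 1`, `β_t = deg a_n`; the printed inclusion itself forces the term of
  maximal `γ` to be unique) and every other monomial `x^k y^j` of `f` (`j < n`, `k ∈ supp a_j`)
  has `β_t < k ∧ k + j < β_t + n`, i.e. the printed `β_t < β_i ≤ β_i + γ_i < β_t + γ_t`. The
  hypothesis `V(f(x, x+1)) = 2t − 2` is typed `V + 2 = 2t` with `f ≠ 0` explicit: Mathlib's
  `V(0) = 0` where the print inherits Avendaño's `V(0) = −2`; as in the parent file the induction
  starts at `f = a₀(x)` (not at `f_{n+1} = 0`), where equality in Descartes'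
  `V(a₀) ≤ t₀ − 1 ≤ 2t₀ − 2` forces `t₀ = 1`, so the printed constant is KEPT. Any linearly ordered
  commutative ring `K`.
* **§3 and Thm. 1** (p0003 L6–8; proof p0005–p0006) → namespace `BihanElHilany2017`:
  - Prop. 7 in the printed point-configuration form for honest term families, `prop_7_family`
    (bridge from the `K[x][y]` statement: the family IS a bivariate polynomial with `T = #ι`);
  - the counts: `V_{I₁}(g) = V(g)` (Descartes, Mathlib), `V_{I₂}(g) = V(g₂)` with
    `g₂ = g(−1−x) = Σᵢ cᵢ(−1)^{αᵢ+βᵢ} x^{βᵢ}(x+1)^{αᵢ}`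
    (`countP_roots_lt_neg_one_le_signVariations`), and — ONE DEVIATION, as in the parent —
    `V_{I₃}` through `x ↦ 1/x` instead of the printed `(x+1)^d g(−x/(x+1))`:
    `g₃ = (x^D g(1/x))(−1−x) = Σᵢ cᵢ(−1)^{(D−αᵢ−βᵢ)+βᵢ} x^{βᵢ}(x+1)^{D−αᵢ−βᵢ}` for any
    `D ≥ αᵢ + βᵢ` (`countP_roots_Ioo_le_signVariations`; `= V_{I₂}(g₁) = V_{I₃}(g)` by the
    printed Lemma 8);
  - the one-sided step "(E:useful) ⇒ `V(g(−1−x)) ≤ 2t − 3`, with equality only in configuration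
    (i0)" for an arbitrary honest family, `signVariations_le_of_config`; the heart
    "`V_{I₁}(g) = 2t−2 ⇒ V_{I₂}, V_{I₃} ≤ 2t−3` and (for `t ≥ 3`) `V_{I₂} + V_{I₃} < 2(2t−3)`",
    `signVariations_le_of_eq` ((i0) and (i1) incompatible AT A THIRD TERM);
  - **Lemma 8** (the `S₃`-symmetry) is NOT typed as printed (Möbius changes of variable); its
    rôle — transporting the previous step to the cases `V_{I₂} = 2t−2`, `V_{I₃} = 2t−2` — is
    played by three reflection identities between the families of `g`, `g₂`, `g₃`
    (`signVariations_family_reflect`, `signVariations_swap_refl`, `signVariations_fam3_swap`,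
    `signVariations_fam3_refl`), giving (E:toshow) `V_{I₁} + V_{I₂} + V_{I₃} ≤ 6t − 9` for `t ≥ 3`
    and `≤ 6t − 8` for `t ≥ 2` (`sum_signVariations_le`);
  - **Thm. 1**: `line_one_one` (`a = b = 1`), `thm_1` (general line, `a ≠ 0`, `3 ≤ t`: count
    `≤ 6t − 7`), `thm_1_two_le` (`2 ≤ t`: `≤ 6t − 6`, a consequence of the printed proof, not
    printed), `thm_1_of_bivariate` (`f ∈ K[x][y]`, `t` read off `f`), the distinct-roots form on
    any line `thm_1_card_roots_le[_of_bivariate]`, and the printed "AT MOST `t` non-zero terms"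
    forms `thm_1_of_bivariate_atMost` / `thm_1_atMost` (arbitrary family, `#ι ≤ t`, `3 ≤ t` —
    the parent's `Avendano2009.thm_1` setting with only `3 ≤ t` added) — proved; and
    `thm_1_asPrinted_counterexample`: **the printed statement ("at most `t` non-zero terms …
    at most `6t − 7`"; abstract: "at most `t` monomials … does not exceed `6t − 7`") is false for
    `t = 2`** — `f = 625x³y³ − 36xy`, `y = x + 1`: `g = x(x+1)(5x−1)(5x+6)(5x+2)(5x+3)` has six
    simple real roots, printed count `6 > 5` (and for `t = 1` the bound is `−1`). The printed
    proof is correct for `t ≥ 3`: its last step uses a third term. TYPED vs PRINTED otherwise as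
    in the parent's `Avendano2009.thm_1` (family form, `g = 0` disjunct explicit, count with
    multiplicity off `{0, −b/a}` plus the two indicators, binder `a ≠ 0`; any linearly ordered
    field). (The arXiv text of the theorem reads "at most three non-zero terms" and "`−a/b`"
    where `t` non-zero terms and `−b/a` are meant.)
* **Thm. 2** (eleven real intersection points for `t = 3`: the curve
  `−0.002404 xy¹⁸ + 29 x⁶y³ + x³y = 0` and the line `y = x + 1`; real dessins d'enfants and
  computer search, §4–§5, p0006–p0009) — NOT typed.

## Context (honest framing)

Same shelf as the parent: a V1 / real-τ DICTIONARY entry for `Summits/ValiantsHypothesis`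
(fewnomial real-root counts for the sums `Σ cᵢ x^{αᵢ}(ax + b)^{βᵢ}`, the sector `m = 2` of the
RealTau crux format; the tree's bounds for this family are now: cubic one-cell
`KoiranPortierTavenas2015.KPT2015_cor_14`, linear `6t − 4` (parent), sharp-for-`t = 3` `6t − 7`
(here, `t ≥ 3`) and `6t − 6` (`t ≥ 2`, sharp for `t = 2`)). Census-neutral: 0 named facts,
0 definitions; moves no route item; VP ≠ VNP is NOT proved and nothing here bears on it.

## References

* [BihanElhilany2017] F. Bihan, B. El Hilany, J. Symbolic Comput. 81 (2017) 88–96,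
  doi:10.1016/j.jsc.2016.12.003, arXiv:1506.03309.
* [Avendano2009] M. Avendaño, J. Symbolic Comput. 44 (2009) 1280–1284,
  doi:10.1016/j.jsc.2008.02.016 (the parent file `LacunaryBivariateOnLine`).
-/

noncomputable section

open Polynomial Finset

namespace Literature.Algebra.Polynomial

/-! ## Sign variations are invariant under reversal: `V(x^d g(1/x)) = V(g)` -/

section Reverse

variable {R : Type*} [Semiring R] [LinearOrder R]

/-- Entries of `coeffList`: the `i`-th entry (from the top) is the coefficient of `x^{deg P − i}`.
[folklore] -/
private theorem getElem_coeffList {P : R[X]} (i : ℕ) (hi : i < P.coeffList.length) :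
    P.coeffList[i] = P.coeff (P.natDegree - i) := by
  classical
  have hP : P ≠ 0 := by
    intro h; rw [h, coeffList_zero] at hi; exact Nat.not_lt_zero _ hi
  have hlen : P.coeffList.length = P.natDegree + 1 := by simp [length_coeffList_eq_ite, hP]
  simp only [coeffList, List.getElem_map, List.getElem_reverse, List.getElem_range,
    List.length_range, withBotSucc_degree_eq_natDegree_add_one hP]
  all_goals (congr 1)

/-- `coeffList P` read backwards = `natTrailingDegree P` zeros, then the coefficient list of the
reversed polynomial `x^{deg P} P(1/x)`. [folklore] -/
private theorem reverse_coeffList (P : R[X]) :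
    P.coeffList.reverse = List.replicate P.natTrailingDegree 0 ++ P.reverse.coeffList := by
  classical
  by_cases hP : P = 0
  · subst hP; simp
  have hR : P.reverse ≠ 0 := fun h => hP (Polynomial.reverse_eq_zero.mp h)
  have hdk := P.natDegree_eq_reverse_natDegree_add_natTrailingDegree
  have hlenP : P.coeffList.length = P.natDegree + 1 := by simp [length_coeffList_eq_ite, hP]
  have hlenR : P.reverse.coeffList.length = P.reverse.natDegree + 1 := by
    simp [length_coeffList_eq_ite, hR]
  apply List.ext_getElem
  · rw [List.length_reverse, List.length_append, List.length_replicate, hlenP, hlenR]; omega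
  · intro i h1 h2
    rw [List.length_reverse, hlenP] at h1
    rw [List.length_append, List.length_replicate, hlenR] at h2
    rw [List.getElem_reverse, getElem_coeffList _ (by rw [hlenP]; omega)]
    simp only [hlenP]
    rw [show P.natDegree - (P.natDegree + 1 - 1 - i) = i by omega]
    rw [List.getElem_append]
    split_ifs with hik
    · rw [List.length_replicate] at hik
      rw [List.getElem_replicate]
      exact coeff_eq_zero_of_lt_natTrailingDegree hik
    · rw [List.length_replicate] at hik
      rw [getElem_coeffList _ (by rw [List.length_replicate, hlenR]; omega), coeff_reverse,
        List.length_replicate, revAt_le (by omega)]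
      congr 1
      omega

/-- **Sign variations are invariant under reversal**: `V(x^d g(1/x)) = V(g)` (`d = deg g`), the
coefficient sequence being read backwards with the trailing zeros dropped ("On the other hand
`V(g) = V(g₁)`", `g₁ = x^d g(1/x)`).
[cite: BihanElhilany2017, §3 (proof of Thm. 1: V(g) = V(g₁)), arXiv:1506.03309 p0006] -/
theorem signVariations_reverse [DecidableEq R] (P : R[X]) :
    P.reverse.signVariations = P.signVariations := by
  classical
  -- the sign sequences (zeros removed) are reverse to each other
  have hσ : (P.reverse.coeffList.map SignType.sign).filter (· ≠ 0) =
      ((P.coeffList.map SignType.sign).filter (· ≠ 0)).reverse := by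
    rw [← List.filter_reverse, ← List.map_reverse, reverse_coeffList, List.map_append,
      List.filter_append, List.map_replicate]
    simp
  -- destuttering a reversed list by `≠` gives a list of the same length (longest `≠`-chain)
  have key : ∀ L : List SignType,
      (L.reverse.destutter (· ≠ ·)).length ≤ (L.destutter (· ≠ ·)).length := by
    intro L
    have h1 : List.Sublist (L.reverse.destutter (· ≠ ·)).reverse L := by
      have := (List.destutter_sublist (R := (· ≠ ·)) L.reverse).reverse
      rwa [List.reverse_reverse] at this
    have h2 : ((L.reverse.destutter (· ≠ ·)).reverse).IsChain (· ≠ ·) := by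
      rw [List.isChain_reverse]
      have := List.isChain_destutter (R := (· ≠ ·)) L.reverse
      exact this.imp fun a b h => fun h' => h h'.symm
    have := List.IsChain.length_le_length_destutter_ne h1 h2
    rwa [List.length_reverse] at this
  unfold signVariations
  rw [hσ]
  have e := le_antisymm (key ((P.coeffList.map SignType.sign).filter (· ≠ 0)))
    (by simpa using key ((P.coeffList.map SignType.sign).filter (· ≠ 0)).reverse)
  rw [e]

/-- Erasing the leading term commutes with multiplication by `x^k`. [folklore] -/
private theorem eraseLead_X_pow_mul' [NoZeroDivisors R] [Nontrivial R] (k : ℕ) (P : R[X]) :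
    (X ^ k * P).eraseLead = X ^ k * P.eraseLead := by
  by_cases hP : P = 0
  · simp [hP]
  ext i
  rw [eraseLead_coeff, coeff_X_pow_mul', coeff_X_pow_mul', natDegree_X_pow_mul k hP,
    eraseLead_coeff]
  by_cases hki : k ≤ i
  · rw [if_pos hki, if_pos hki]
    by_cases h1 : i = P.natDegree + k
    · rw [if_pos h1, if_pos (by omega)]
    · rw [if_neg h1, if_neg (by omega)]
  · rw [if_neg hki, if_neg hki]
    split_ifs <;> rfl

/-- `V(x^k P) = V(P)` over any linearly ordered semiring without zero divisors (the tree's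
`Literature.Algebra.Polynomial.Descartes.signVariations_X_pow_mul` is the case `ℝ`; same proof).
[folklore] -/
private theorem signVariations_X_pow_mul' [NoZeroDivisors R] [Nontrivial R] (k : ℕ) (P : R[X]) :
    (X ^ k * P).signVariations = P.signVariations := by
  induction hc : P.support.card using Nat.strong_induction_on generalizing P with
  | _ c ih =>
    by_cases hP : P = 0
    · simp [hP]
    have hXP : X ^ k * P ≠ 0 := mul_ne_zero (pow_ne_zero _ X_ne_zero) hP
    rw [signVariations_eq_eraseLead_add_ite hP, signVariations_eq_eraseLead_add_ite hXP,
      eraseLead_X_pow_mul', ih _ (hc ▸ eraseLead_support_card_lt hP) _ rfl]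
    have h1 : (X ^ k * P).leadingCoeff = P.leadingCoeff := by
      rw [(commute_X_pow P k).eq, leadingCoeff_mul_X_pow]
    have h2 : (X ^ k * P.eraseLead).leadingCoeff = P.eraseLead.leadingCoeff := by
      rw [(commute_X_pow P.eraseLead k).eq, leadingCoeff_mul_X_pow]
    rw [h1, h2]

/-- `V(reflect N g) = V(g)` for `N ≥ deg g` (`reflect N g = x^{N − deg g} · reverse g`).
[cite: BihanElhilany2017, §3 (proof of Thm. 1: V(g) = V(g₁)), arXiv:1506.03309 p0006] -/
theorem signVariations_reflect {S : Type*} [CommSemiring S] [LinearOrder S] [NoZeroDivisors S]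
    [Nontrivial S] [DecidableEq S] (P : S[X]) {N : ℕ} (hN : P.natDegree ≤ N) :
    (P.reflect N).signVariations = P.signVariations := by
  obtain ⟨e, he⟩ := Nat.exists_eq_add_of_le hN
  have hrev : P.reflect N = P.reverse * X ^ e := by
    have := reflect_mul P 1 (F := P.natDegree) (G := e) le_rfl (by simp)
    rwa [mul_one, reflect_one, ← he] at this
  rw [hrev, mul_comm, signVariations_X_pow_mul', signVariations_reverse]

/-- Degree of a reflection: `deg (reflect N f) = N − trailing(f)` for `f ≠ 0`, `deg f ≤ N`.
[folklore] -/
private theorem natDegree_reflect_eq {S : Type*} [Semiring S] [NoZeroDivisors S] {f : S[X]}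
    (hf : f ≠ 0) {N : ℕ} (hN : f.natDegree ≤ N) :
    (f.reflect N).natDegree = N - f.natTrailingDegree := by
  haveI : Nontrivial S := Nontrivial.of_polynomial_ne hf
  obtain ⟨e, he⟩ := Nat.exists_eq_add_of_le hN
  have hrev : f.reflect N = f.reverse * X ^ e := by
    have := reflect_mul f 1 (F := f.natDegree) (G := e) le_rfl (by simp)
    rwa [mul_one, reflect_one, ← he] at this
  have hr0 : f.reverse ≠ 0 := fun h => hf (Polynomial.reverse_eq_zero.mp h)
  rw [hrev, natDegree_mul hr0 (pow_ne_zero _ X_ne_zero), natDegree_X_pow, reverse_natDegree, he]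
  have := f.natTrailingDegree_le_natDegree
  omega

/-- Reflection preserves the number of terms. [folklore] -/
private theorem card_support_reflect {S : Type*} [Semiring S] (f : S[X]) (N : ℕ) :
    (f.reflect N).support.card = f.support.card := by
  rw [reflect_support, Finset.card_image_of_injective _ (revAt N).injective]

end Reverse

/-! ## Bihan–El Hilany 2017, Lemma 5: the equality case of Avendaño's Remark 6 -/

section Lemma5

variable {R : Type*} [CommRing R] [LinearOrder R] [IsStrictOrderedRing R]

omit [IsStrictOrderedRing R] in
/-- If `deg f ≤ deg g` then adding the `t`-nomial `g ≠ 0` cannot realise the extremal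
`V(f + g) = V(f) + 2t` of Remark 6: peeling the top term of `g` costs at most `1`, the rest at most
`2(t − 1)`. [cite: BihanElhilany2017, Lemma 5 (proof), arXiv:1506.03309 p0004] -/
theorem signVariations_add_lt_of_natDegree_le {f g : R[X]} (hg : g ≠ 0)
    (hdeg : f.natDegree ≤ g.natDegree) :
    (f + g).signVariations < f.signVariations + 2 * g.support.card := by
  set c := g.leadingCoeff with hc_def
  set e := g.natDegree with he_def
  set g' := g.eraseLead with hg'_def
  have hc : c ≠ 0 := leadingCoeff_ne_zero.mpr hg
  have hgdec : g' + C c * X ^ e = g := eraseLead_add_C_mul_X_pow g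
  have hcard : g'.support.card + 1 = g.support.card := card_support_eraseLead_add_one hg
  have h1 : (f + g').signVariations ≤ f.signVariations + 2 * g'.support.card :=
    signVariations_add_le_add_two_mul_card_support f g'
  have hg'deg : g'.degree < e := by
    have := degree_eraseLead_lt hg; rwa [degree_eq_natDegree hg] at this
  have hfdeg : f.degree ≤ e := (degree_le_natDegree).trans (by exact_mod_cast hdeg)
  set h := f + g' with hh_def
  have hhdeg : h.degree ≤ e := (degree_add_le f g').trans (max_le hfdeg hg'deg.le)
  have h2 : (f + g).signVariations ≤ h.signVariations + 1 := by
    rw [← hgdec, ← add_assoc, ← hh_def]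
    by_cases hh : h.degree < e
    · rw [add_comm]; exact signVariations_C_mul_X_pow_add_le hc hh
    · have hh0 : h ≠ 0 := by
        intro h0; rw [h0, degree_zero] at hh; exact hh (WithBot.bot_lt_coe e)
      have hhe : h.natDegree = e := by
        have h3 : (e : WithBot ℕ) ≤ h.degree := not_lt.mp hh
        rw [degree_eq_natDegree hh0] at h3 hhdeg
        exact le_antisymm (by exact_mod_cast hhdeg) (by exact_mod_cast h3)
      have hhdec : h.eraseLead + C h.leadingCoeff * X ^ e = h := by
        rw [← hhe]; exact eraseLead_add_C_mul_X_pow h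
      have hEdeg : h.eraseLead.degree < e := by
        have := degree_eraseLead_lt hh0; rwa [degree_eq_natDegree hh0, hhe] at this
      have hsum : h + C c * X ^ e = C (h.leadingCoeff + c) * X ^ e + h.eraseLead := by
        conv_lhs => rw [← hhdec]
        rw [C_add]; ring
      rw [hsum]
      have hle : h.eraseLead.signVariations ≤ h.signVariations := signVariations_eraseLead_le h
      by_cases hz : h.leadingCoeff + c = 0
      · rw [hz, C_0, zero_mul, zero_add]; omega
      · exact (signVariations_C_mul_X_pow_add_le hz hEdeg).trans (by omega)
  omega

/-- **Bihan–El Hilany 2017, Lemma 5**: "If `f, g ∈ ℝ[X]`, `g` has `t` terms and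
`V(f + g) = V(f) + 2t`, then `𝒩(g)` is contained in `𝒩°(f)`" — the Newton polytope (here: the
segment from the trailing to the leading exponent) of `g` lies in the INTERIOR of that of `f`, i.e.
`trailing(f) < trailing(g)` and `deg g < deg f`. Typed with `t = g.support.card`, `g ≠ 0` (for
`g = 0` the printed conclusion is vacuous), any linearly ordered commutative ring; the printed
"symmetric" second case is done by reflecting (`signVariations_reflect`).
[cite: BihanElhilany2017, Lemma 5, arXiv:1506.03309 p0004] -/
theorem BihanElHilany2017_lemma_5 {f g : R[X]} (hg : g ≠ 0)
    (heq : (f + g).signVariations = f.signVariations + 2 * g.support.card) :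
    f.natTrailingDegree < g.natTrailingDegree ∧ g.natDegree < f.natDegree := by
  classical
  refine ⟨?_, ?_⟩
  · by_contra hle
    push Not at hle
    -- reflect about `N = max deg`: trailing exponents become leading ones
    set N := max f.natDegree g.natDegree with hN_def
    have hfN : f.natDegree ≤ N := le_max_left _ _
    have hgN : g.natDegree ≤ N := le_max_right _ _
    have hfgN : (f + g).natDegree ≤ N := (natDegree_add_le f g).trans (max_le hfN hgN)
    have hg' : g.reflect N ≠ 0 := by
      intro h0
      have := card_support_reflect g N
      rw [h0, support_zero, Finset.card_empty] at this
      exact hg (Polynomial.card_support_eq_zero.mp this.symm)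
    have hdeg' : (f.reflect N).natDegree ≤ (g.reflect N).natDegree := by
      by_cases hf : f = 0
      · rw [hf, reflect_zero, natDegree_zero]; exact Nat.zero_le _
      · rw [natDegree_reflect_eq hf hfN, natDegree_reflect_eq hg hgN]
        exact Nat.sub_le_sub_left hle N
    have hlt := signVariations_add_lt_of_natDegree_le hg' hdeg'
    rw [← reflect_add, signVariations_reflect (f + g) hfgN, signVariations_reflect f hfN,
      card_support_reflect, heq] at hlt
    exact lt_irrefl _ hlt
  · by_contra hle
    push Not at hle
    have hlt := signVariations_add_lt_of_natDegree_le hg hle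
    omega

end Lemma5

/-! ## Bihan–El Hilany 2017, Proposition 7: the equality case of Avendaño's Proposition 7 -/

section Prop7

variable {K : Type*} [CommRing K] [LinearOrder K] [IsStrictOrderedRing K]

omit [LinearOrder K] [IsStrictOrderedRing K] in
/-- The number of terms of `f ∈ K[x][y]` summed degree by degree in `y` over `j < N` equals the
number of terms summed over the `y`-support, when `N` exceeds the `y`-degree (local copy of the
bookkeeping lemma of `LacunaryBivariateOnLine`). [folklore] -/
private theorem sum_range_card_support_coeff' (f : Polynomial (Polynomial K)) {N : ℕ}
    (hN : f.natDegree < N) :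
    ∑ j ∈ Finset.range N, (f.coeff j).support.card = ∑ j ∈ f.support, (f.coeff j).support.card := by
  symm
  apply Finset.sum_subset
  · intro j hj
    exact Finset.mem_range.mpr (lt_of_le_of_lt (le_natDegree_of_mem_supp j hj) hN)
  · intro j _ hj
    rw [notMem_support_iff.mp hj, support_zero, Finset.card_empty]

/-- The Newton-polytope bookkeeping of the printed proof (its display (5),
`𝒩°((x+1)^{α_k} f_k(x,x+1)) ⊂ 𝒩°(a_n(x)(x+1)^{α_n})`, run to `k = 1`): if the top `y`-coefficient
of `f ∈ K[x][y]` is a single monomial `b x^β` and every other monomial `x^k y^j` of `f` has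
`β < k` and `k + j < β + deg_y f`, then `f(x, x+1) ≠ 0` has trailing exponent exactly `β` and degree
exactly `β + deg_y f` (both with coefficient `b`).
[cite: BihanElhilany2017, Prop. 7 (proof, display (5)), arXiv:1506.03309 p0004] -/
theorem BihanElHilany2017_prop_7_shape {f : Polynomial (Polynomial K)} (hf : f ≠ 0)
    (h1 : f.leadingCoeff.support.card = 1)
    (h2 : ∀ j < f.natDegree, ∀ k ∈ (f.coeff j).support,
      f.leadingCoeff.natDegree < k ∧ k + j < f.leadingCoeff.natDegree + f.natDegree) :
    f.eval (X + C 1) ≠ 0 ∧ (f.eval (X + C 1)).natTrailingDegree = f.leadingCoeff.natDegree ∧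
      (f.eval (X + C 1)).natDegree = f.leadingCoeff.natDegree + f.natDegree := by
  set p : K[X] := X + C 1 with hp_def
  set β := f.leadingCoeff.natDegree with hβ_def
  set n := f.natDegree with hn_def
  set b := f.leadingCoeff.leadingCoeff with hb_def
  have hb : b ≠ 0 := leadingCoeff_ne_zero.mpr (leadingCoeff_ne_zero.mpr hf)
  have hmono : f.leadingCoeff = C b * X ^ β := (C_mul_X_pow_eq_self h1.le).symm
  have hp0 : p ≠ 0 := X_add_C_ne_zero 1
  -- split off the top term of `f(x, p) = Σ_{j ≤ n} a_j(x) p^j`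
  set Rest := ∑ j ∈ Finset.range n, f.coeff j * p ^ j with hRest_def
  have heval : f.eval p = Rest + C b * X ^ β * p ^ n := by
    rw [eval_eq_sum_range, Finset.sum_range_succ, ← hRest_def, coeff_natDegree, hmono]
  have hRest_lo : ∀ i ≤ β, Rest.coeff i = 0 := by
    intro i hi
    rw [hRest_def, finsetSum_coeff]
    refine Finset.sum_eq_zero fun j hj => ?_
    rw [Finset.mem_range] at hj
    by_cases hq : f.coeff j = 0
    · rw [hq, zero_mul, coeff_zero]
    · apply coeff_eq_zero_of_lt_natTrailingDegree
      have hk := (h2 j hj _ (natTrailingDegree_mem_support_of_nonzero hq)).1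
      rw [natTrailingDegree_mul hq (pow_ne_zero _ hp0)]
      omega
  have hRest_hi : ∀ i, β + n ≤ i → Rest.coeff i = 0 := by
    intro i hi
    rw [hRest_def, finsetSum_coeff]
    refine Finset.sum_eq_zero fun j hj => ?_
    rw [Finset.mem_range] at hj
    by_cases hq : f.coeff j = 0
    · rw [hq, zero_mul, coeff_zero]
    · apply coeff_eq_zero_of_natDegree_lt
      have hk := (h2 j hj _ (natDegree_mem_support_of_nonzero hq)).2
      calc (f.coeff j * p ^ j).natDegree
          ≤ (f.coeff j).natDegree + (p ^ j).natDegree := natDegree_mul_le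
        _ ≤ (f.coeff j).natDegree + j * p.natDegree := by
          gcongr
          exact natDegree_pow_le
        _ = (f.coeff j).natDegree + j := by rw [hp_def, natDegree_X_add_C, mul_one]
        _ < i := by omega
  have htop : ∀ i, (C b * X ^ β * p ^ n).coeff i =
      if β ≤ i then b * ((n.choose (i - β) : ℕ) : K) else 0 := by
    intro i
    rw [mul_assoc, coeff_C_mul, coeff_X_pow_mul', hp_def]
    split_ifs with h
    · rw [coeff_X_add_C_pow, one_pow, one_mul]
    · rw [mul_zero]
  have hcoeff : ∀ i, (f.eval p).coeff i =
      Rest.coeff i + if β ≤ i then b * ((n.choose (i - β) : ℕ) : K) else 0 := by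
    intro i; rw [heval, coeff_add, htop]
  have hβ : (f.eval p).coeff β = b := by
    rw [hcoeff, hRest_lo β le_rfl, if_pos le_rfl, Nat.sub_self, Nat.choose_zero_right, Nat.cast_one,
      mul_one, zero_add]
  have hβn : (f.eval p).coeff (β + n) = b := by
    rw [hcoeff, hRest_hi _ le_rfl, if_pos (Nat.le_add_right _ _), Nat.add_sub_cancel_left,
      Nat.choose_self, Nat.cast_one, mul_one, zero_add]
  have hlo : ∀ i < β, (f.eval p).coeff i = 0 := by
    intro i hi; rw [hcoeff, hRest_lo i hi.le, if_neg (not_le.mpr hi), add_zero]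
  have hhi : ∀ i, β + n < i → (f.eval p).coeff i = 0 := by
    intro i hi
    rw [hcoeff, hRest_hi i hi.le, if_pos (by omega), Nat.choose_eq_zero_of_lt (by omega),
      Nat.cast_zero, mul_zero, add_zero]
  have hne : f.eval p ≠ 0 := fun h0 => hb (by rw [← hβ, h0, coeff_zero])
  refine ⟨hne, le_antisymm (natTrailingDegree_le_of_ne_zero (by rw [hβ]; exact hb))
    (le_natTrailingDegree hne hlo), le_antisymm (natDegree_le_iff_coeff_eq_zero.mpr hhi)
    (le_natDegree_of_ne_zero (by rw [hβn]; exact hb))⟩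

/-- Proposition 7 in "range" form — the induction actually run, along Horner's scheme in `y`
(`f(x, p) = p · (divX f)(x, p) + a₀(x)`, `p = x + 1`): the equality `V(f(x,x+1)) = 2t − 2` forces
each of Remark 6 / Lemma 5 / Proposition 7 (for `divX f`) to be an equality ((3) of the print), the
induction hypothesis gives the shape of `(x+1)·(divX f)(x, x+1)`, and Lemma 5 of the paper places
the monomials of `a₀`. [cite: BihanElhilany2017, Prop. 7 (proof), arXiv:1506.03309 p0004] -/
private theorem prop_7_aux :
    ∀ (N : ℕ) (f : Polynomial (Polynomial K)), f ≠ 0 → f.natDegree < N →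
      (f.eval (X + C 1)).signVariations + 2 = 2 * ∑ j ∈ Finset.range N, (f.coeff j).support.card →
      f.leadingCoeff.support.card = 1 ∧
        ∀ j < f.natDegree, ∀ k ∈ (f.coeff j).support,
          f.leadingCoeff.natDegree < k ∧ k + j < f.leadingCoeff.natDegree + f.natDegree := by
  intro N
  induction N with
  | zero => intro f _ h; exact absurd h (Nat.not_lt_zero _)
  | succ N ih =>
    intro f hf hdeg hV
    set p : K[X] := X + C 1 with hp_def
    have hfdec : X * f.divX + C (f.coeff 0) = f := X_mul_divX_add f
    have heval : f.eval p = p * (f.divX.eval p) + f.coeff 0 := by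
      conv_lhs => rw [← hfdec]
      rw [eval_add, eval_mul, eval_X, eval_C]
    rw [Finset.sum_range_succ'] at hV
    simp only [coeff_divX.symm] at hV
    by_cases hD : f.divX = 0
    · -- `f = a₀(x)`: `V(a₀) + 2 = 2 t₀` together with `V(a₀) ≤ t₀ − 1` forces `t₀ = 1`
      have hfC : f = C (f.coeff 0) := divX_eq_zero_iff.mp hD
      have hf0 : f.coeff 0 ≠ 0 := by intro h0; apply hf; rw [hfC, h0, C_0]
      have hn : f.natDegree = 0 := by rw [hfC]; exact natDegree_C _
      have hlc : f.leadingCoeff = f.coeff 0 := by rw [leadingCoeff, hn]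
      rw [heval, hD] at hV
      simp only [eval_zero, mul_zero, zero_add, coeff_zero, support_zero, Finset.card_empty,
        Finset.sum_const_zero] at hV
      have h1 := Literature.Computability.AlgebraicComplexity.signVariations_lt_card_support hf0
      refine ⟨?_, fun j hj => absurd hj (by rw [hn]; exact Nat.not_lt_zero _)⟩
      rw [hlc]; omega
    · have hpos : 0 < f.natDegree := by
        by_contra h0
        exact hD (divX_eq_zero_iff.mpr (eq_C_of_natDegree_eq_zero (Nat.eq_zero_of_not_pos h0)))
      have hdegD : f.divX.natDegree + 1 = f.natDegree := by
        rw [natDegree_divX_eq_natDegree_tsub_one]; omega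
      have hdegD' : f.divX.natDegree < N := by omega
      have hlc : f.leadingCoeff = f.divX.leadingCoeff := by
        rw [leadingCoeff, leadingCoeff, coeff_divX, hdegD]
      -- the three inequalities of Avendaño's proof, all forced to be equalities
      have h1 := signVariations_add_le_add_two_mul_card_support (p * f.divX.eval p) (f.coeff 0)
      have h2 := signVariations_X_add_C_mul_le (zero_lt_one' K) (f.divX.eval p)
      rw [← hp_def] at h2
      have h3 : (f.divX.eval p).signVariations + 2 ≤
          2 * ∑ j ∈ Finset.range N, (f.divX.coeff j).support.card := by
        have := Avendano2009_prop_7 ({0} : Finset ℕ) (fun _ => (1 : K)) (fun _ _ => zero_lt_one)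
          f.divX hD
        simp only [Finset.prod_singleton] at this
        rwa [← sum_range_card_support_coeff' f.divX hdegD', ← hp_def] at this
      rw [heval] at hV
      have hVD : (f.divX.eval p).signVariations + 2 =
          2 * ∑ j ∈ Finset.range N, (f.divX.coeff j).support.card := by omega
      have hVa : (p * f.divX.eval p + f.coeff 0).signVariations =
          (p * f.divX.eval p).signVariations + 2 * (f.coeff 0).support.card := by omega
      obtain ⟨ih1, ih2⟩ := ih f.divX hD hdegD' hVD
      refine ⟨by rw [hlc]; exact ih1, ?_⟩
      -- shape of `D(x, x+1)` and of `(x+1)·D(x, x+1)`, `D = divX f`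
      obtain ⟨hDne, htr, hdg⟩ := BihanElHilany2017_prop_7_shape hD ih1 ih2
      rw [← hp_def] at hDne htr hdg
      have hp0 : p ≠ 0 := X_add_C_ne_zero 1
      have hptr : p.natTrailingDegree = 0 := by
        apply Nat.le_zero.mp
        apply natTrailingDegree_le_of_ne_zero
        rw [hp_def, coeff_add, coeff_X_zero, coeff_C_zero, zero_add]; exact one_ne_zero
      have htr' : (p * f.divX.eval p).natTrailingDegree = f.leadingCoeff.natDegree := by
        rw [natTrailingDegree_mul hp0 hDne, hptr, htr, hlc, zero_add]
      have hdg' : (p * f.divX.eval p).natDegree = f.leadingCoeff.natDegree + f.natDegree := by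
        rw [natDegree_mul hp0 hDne, hdg, hp_def, natDegree_X_add_C, hlc]; omega
      intro j hj k hk
      cases j with
      | zero =>
        -- `j = 0`: Lemma 5 of the paper on `(x+1)·D(x, x+1) + a₀(x)`
        have ha0 : f.coeff 0 ≠ 0 := by
          intro h0; rw [h0, support_zero] at hk; exact Finset.notMem_empty _ hk
        obtain ⟨hlt1, hlt2⟩ := BihanElHilany2017_lemma_5 ha0 hVa
        rw [htr'] at hlt1
        rw [hdg'] at hlt2
        have hk1 := natTrailingDegree_le_of_mem_supp k hk
        have hk2 := le_natDegree_of_mem_supp k hk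
        constructor <;> omega
      | succ j =>
        -- `j + 1`: the induction hypothesis for `D`
        have hk' : k ∈ (f.divX.coeff j).support := by rwa [coeff_divX]
        have := ih2 j (by omega) k hk'
        rw [hlc]; omega

/-- **Bihan–El Hilany 2017, Proposition 7**: "Let `f ∈ ℝ[x, y]` be a polynomial with `t` non-zero
terms. Write it as `f(x, y) = Σ_{i=1}^t b_i x^{β_i} y^{γ_i}` with `0 ≤ γ_1 ≤ γ_2 ≤ ⋯ ≤ γ_t`. If
`V(f(x, x+1)) = 2t − 2`, then `𝒩(b_i x^{β_i}(x+1)^{γ_i}) ⊂ 𝒩°(b_t x^{β_t}(x+1)^{γ_t})` (in other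
words, `β_t < β_i ≤ β_i + γ_i < β_t + γ_t`) for `i = 1, …, t − 1`."
TYPED (coefficient-support reading of the printed point configuration): `f : K[x][y]` with
`y`-coefficients `a_j = f.coeff j ∈ K[x]`, `t = Σ_j #supp a_j`, hypothesis `V(f(x, x+1)) + 2 = 2t`
(`f ≠ 0`; Mathlib's `V(0) = 0`); conclusion: the top `y`-coefficient `a_n`, `n = deg_y f = γ_t`, is
a single monomial `b_t x^{β_t}` (`β_t = deg a_n`; the printed inclusion itself forces the term of
maximal `γ` to be unique), and every other monomial `x^k y^j` of `f` (`j < n`, `k ∈ supp a_j`) has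
`β_t < k` and `k + j < β_t + n`. Any linearly ordered commutative ring `K`. Lemmas 3, 4 and
Proposition 6 of the paper are Avendaño's Lemma 5, Remark 6 and Proposition 7
(`signVariations_X_add_C_mul_le`, `signVariations_add_le_add_two_mul_card_support`,
`Avendano2009_prop_7` of `LacunaryBivariateOnLine`), used, not restated.
[cite: BihanElhilany2017, Prop. 7, arXiv:1506.03309 p0004] -/
theorem BihanElHilany2017_prop_7 (f : Polynomial (Polynomial K)) (hf : f ≠ 0)
    (hV : (f.eval (X + C 1)).signVariations + 2 = 2 * ∑ j ∈ f.support, (f.coeff j).support.card) :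
    f.leadingCoeff.support.card = 1 ∧
      ∀ j < f.natDegree, ∀ k ∈ (f.coeff j).support,
        f.leadingCoeff.natDegree < k ∧ k + j < f.leadingCoeff.natDegree + f.natDegree := by
  rw [← sum_range_card_support_coeff' f (Nat.lt_succ_self _)] at hV
  exact prop_7_aux _ f hf (Nat.lt_succ_self _) hV

/-- Proposition 7, consequence used in §3: in the equality case `V(f(x,x+1)) = 2t − 2` the Newton
polytope of `g = f(x, x+1)` is that of its top term, `[β_t, β_t + γ_t]`: `g ≠ 0`,
`trailing(g) = β_t`, `deg g = β_t + γ_t`.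
[cite: BihanElhilany2017, Prop. 7 and §3, arXiv:1506.03309 p0004–p0005] -/
theorem BihanElHilany2017_prop_7_newtonPolytope (f : Polynomial (Polynomial K)) (hf : f ≠ 0)
    (hV : (f.eval (X + C 1)).signVariations + 2 = 2 * ∑ j ∈ f.support, (f.coeff j).support.card) :
    f.eval (X + C 1) ≠ 0 ∧ (f.eval (X + C 1)).natTrailingDegree = f.leadingCoeff.natDegree ∧
      (f.eval (X + C 1)).natDegree = f.leadingCoeff.natDegree + f.natDegree := by
  obtain ⟨h1, h2⟩ := BihanElHilany2017_prop_7 f hf hV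
  exact BihanElHilany2017_prop_7_shape hf h1 h2

end Prop7

/-! ## §3: Theorem 1 (the bound `6t − 7`)

Throughout, the `t` terms of `f` are an explicitly indexed family `cᵢ x^{αᵢ} y^{βᵢ}`, `i ∈ ι`
(as in the parent's `Avendano2009.thm_1`), now with the honesty constraints that make `t = #ι`
the true number of non-zero terms: `cᵢ ≠ 0` and `i ↦ (αᵢ, βᵢ)` injective. On the line
`y = x + 1`, `g = Σᵢ cᵢ x^{αᵢ}(x+1)^{βᵢ}`; the printed `V_{I₂}(g) = V(g(−1−x))` is `V` of
`g₂ = Σᵢ cᵢ(−1)^{αᵢ+βᵢ} x^{βᵢ}(x+1)^{αᵢ}` (the parent's `comp_neg_X_sub_one`), and the printed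
`V_{I₃}(g) = V((x+1)^d g(−x/(x+1)))` is replaced (as in the parent) by `V` of
`g₃ = Σᵢ cᵢ(−1)^{(D−αᵢ−βᵢ)+βᵢ} x^{βᵢ}(x+1)^{D−αᵢ−βᵢ} = (x^D g(1/x))(−1−x)` for any
`D ≥ αᵢ + βᵢ` (`= V_{I₂}(g₁)`, which Lemma 8 of the paper identifies with `V_{I₃}(g)`). -/

namespace BihanElHilany2017

section Bridge

variable {K : Type*} [CommRing K] [LinearOrder K] [IsStrictOrderedRing K]
variable {ι : Type*} [Fintype ι] (c : ι → K) (α β : ι → ℕ)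

omit [LinearOrder K] [IsStrictOrderedRing K] in
/-- The coefficient of `x^k y^j` in the bivariate polynomial `F = Σᵢ (cᵢ x^{αᵢ}) y^{βᵢ}` of a term
family. [folklore] -/
private theorem coeff_coeff_family (j k : ℕ) :
    ((∑ i, monomial (β i) (C (c i) * X ^ (α i)) : Polynomial (Polynomial K)).coeff j).coeff k =
      ∑ i, if β i = j ∧ α i = k then c i else 0 := by
  rw [finsetSum_coeff, finsetSum_coeff]
  refine Finset.sum_congr rfl fun i _ => ?_
  rw [coeff_monomial]
  by_cases h1 : β i = j
  · rw [if_pos h1, coeff_C_mul_X_pow]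
    by_cases h2 : α i = k
    · rw [if_pos h2.symm, if_pos ⟨h1, h2⟩]
    · rw [if_neg (fun h => h2 h.symm), if_neg (fun h => h2 h.2)]
  · rw [if_neg h1, coeff_zero, if_neg (fun h => h1 h.1)]

omit [LinearOrder K] [IsStrictOrderedRing K] in
/-- For an honest term family (`cᵢ ≠ 0`, distinct exponent pairs) the monomials of
`F = Σᵢ (cᵢ x^{αᵢ}) y^{βᵢ}` are exactly the `x^{αᵢ} y^{βᵢ}`. [folklore] -/
private theorem mem_support_coeff_family_iff (hc : ∀ i, c i ≠ 0)
    (hinj : Function.Injective fun i => (α i, β i)) (j k : ℕ) :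
    k ∈ ((∑ i, monomial (β i) (C (c i) * X ^ (α i)) : Polynomial (Polynomial K)).coeff j).support
      ↔ ∃ i, β i = j ∧ α i = k := by
  classical
  rw [mem_support_iff, coeff_coeff_family]
  constructor
  · intro h
    obtain ⟨i, _, hi⟩ := Finset.exists_ne_zero_of_sum_ne_zero h
    refine ⟨i, ?_⟩
    by_contra hcon
    exact hi (if_neg hcon)
  · rintro ⟨i, hij, hik⟩
    rw [Finset.sum_eq_single i]
    · rw [if_pos ⟨hij, hik⟩]; exact hc i
    · intro i' _ hne
      rw [if_neg]
      rintro ⟨h1, h2⟩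
      apply hne
      apply hinj
      simp only [Prod.mk.injEq]
      exact ⟨h2.trans hik.symm, h1.trans hij.symm⟩
    · intro h; exact absurd (Finset.mem_univ i) h

/-- **Proposition 7 for term families** (the printed point-configuration form): if
`g = Σᵢ cᵢ x^{αᵢ}(x+1)^{βᵢ}` with `cᵢ ≠ 0`, distinct `(αᵢ, βᵢ)` and `t = #ι` has
`V(g) = 2t − 2`, then there is a term `i₀` (the one of largest `β`) with
`α_{i₀} < αᵢ` and `αᵢ + βᵢ < α_{i₀} + β_{i₀}` for every other `i` — the printed
"`β_t < β_i ≤ β_i + γ_i < β_t + γ_t` for `i = 1, …, t − 1`".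
[cite: BihanElhilany2017, Prop. 7, arXiv:1506.03309 p0004] -/
theorem prop_7_family (hc : ∀ i, c i ≠ 0) (hinj : Function.Injective fun i => (α i, β i))
    (hV : (∑ i, C (c i) * X ^ (α i) * (X + C 1) ^ (β i)).signVariations + 2 =
      2 * Fintype.card ι) :
    ∃ i₀, ∀ i, i ≠ i₀ → α i₀ < α i ∧ α i + β i < α i₀ + β i₀ := by
  classical
  set F : Polynomial (Polynomial K) := ∑ i, monomial (β i) (C (c i) * X ^ (α i)) with hF_def
  have hFeval : F.eval (X + C 1) = ∑ i, C (c i) * X ^ (α i) * (X + C 1) ^ (β i) := by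
    rw [hF_def, eval_finsetSum]
    refine Finset.sum_congr rfl fun i _ => ?_
    rw [eval_monomial]
  have hmem : ∀ j k, k ∈ (F.coeff j).support ↔ ∃ i, β i = j ∧ α i = k :=
    mem_support_coeff_family_iff c α β hc hinj
  have hβmem : ∀ i, β i ∈ F.support := by
    intro i
    rw [mem_support_iff]
    intro h0
    have := (hmem (β i) (α i)).mpr ⟨i, rfl, rfl⟩
    rw [h0, support_zero] at this
    exact Finset.notMem_empty _ this
  have hι : 0 < Fintype.card ι := by omega
  obtain ⟨i₁⟩ := Fintype.card_pos_iff.mp hι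
  have hF0 : F ≠ 0 := fun h0 => by
    have := hβmem i₁
    rw [h0, support_zero] at this
    exact Finset.notMem_empty _ this
  -- `T(F) ≤ #ι` (in fact `=`)
  have hT : ∑ j ∈ F.support, (F.coeff j).support.card ≤ Fintype.card ι := by
    have hsub : ∀ j, (F.coeff j).support = (Finset.univ.filter (fun i => β i = j)).image α := by
      intro j; ext k
      rw [hmem, Finset.mem_image]
      simp only [Finset.mem_filter, Finset.mem_univ, true_and]
    calc ∑ j ∈ F.support, (F.coeff j).support.card
        ≤ ∑ j ∈ F.support, (Finset.univ.filter (fun i => β i = j)).card := by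
          refine Finset.sum_le_sum fun j _ => ?_
          rw [hsub]; exact Finset.card_image_le
      _ = (Finset.univ : Finset ι).card :=
          (Finset.card_eq_sum_card_fiberwise (fun i _ => hβmem i)).symm
      _ = Fintype.card ι := Finset.card_univ
  have h7 := Avendano2009_prop_7 ({0} : Finset ℕ) (fun _ => (1 : K)) (fun _ _ => zero_lt_one)
    F hF0
  simp only [Finset.prod_singleton] at h7
  have hVF : (F.eval (X + C 1)).signVariations + 2 =
      2 * ∑ j ∈ F.support, (F.coeff j).support.card := by
    rw [hFeval] at h7 ⊢; omega
  obtain ⟨h1, h2⟩ := BihanElHilany2017_prop_7 F hF0 hVF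
  obtain ⟨k₀, hk₀⟩ := Finset.card_eq_one.mp h1
  have hk₀mem : k₀ ∈ (F.coeff F.natDegree).support := by
    rw [coeff_natDegree, hk₀]; exact Finset.mem_singleton_self _
  obtain ⟨i₀, hβ₀, hα₀⟩ := (hmem _ _).mp hk₀mem
  have hlcdeg : F.leadingCoeff.natDegree = k₀ := by
    have := natDegree_mem_support_of_nonzero (leadingCoeff_ne_zero.mpr hF0)
    rw [hk₀, Finset.mem_singleton] at this
    exact this
  refine ⟨i₀, fun i hi => ?_⟩
  have hβi_le : β i ≤ F.natDegree := le_natDegree_of_mem_supp _ (hβmem i)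
  have hβi_lt : β i < F.natDegree := by
    rcases hβi_le.lt_or_eq with h | h
    · exact h
    · exfalso
      have := (hmem F.natDegree (α i)).mpr ⟨i, h, rfl⟩
      rw [coeff_natDegree, hk₀, Finset.mem_singleton] at this
      apply hi
      apply hinj
      simp only [Prod.mk.injEq]
      exact ⟨this.trans hα₀.symm, h.trans hβ₀.symm⟩
  have := h2 (β i) hβi_lt (α i) ((hmem _ _).mpr ⟨i, rfl, rfl⟩)
  rw [hlcdeg, ← hα₀, ← hβ₀] at this
  exact this

end Bridge

section Config

variable {K : Type*} [CommRing K] [LinearOrder K] [IsStrictOrderedRing K]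
variable {ι : Type*} [Fintype ι]

/-- Avendaño's Proposition 7 for a family on the line `y = x + 1`, including the case `g = 0`
(Mathlib's `V(0) = 0`): `V(Σᵢ dᵢ x^{μᵢ}(x+1)^{νᵢ}) + 2 ≤ 2 #ι` once `#ι ≥ 1`.
[cite: Avendano2009, Prop. 7] -/
private theorem signVariations_family_add_two_le (d : ι → K) (μ ν : ι → ℕ)
    (hι : 1 ≤ Fintype.card ι) :
    (∑ i, C (d i) * X ^ (μ i) * (X + C 1) ^ (ν i)).signVariations + 2 ≤ 2 * Fintype.card ι := by
  classical
  by_cases h0 : ∑ i, C (d i) * X ^ (μ i) * (X + C 1) ^ (ν i) = 0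
  · rw [h0, signVariations_zero]; omega
  · have h7 := Avendano2009_prop_7_family (Finset.univ : Finset (Fin 1)) (fun _ => (1 : K))
      (fun _ _ => one_pos) d μ ν
    simp only [Fin.prod_univ_one] at h7
    exact h7 h0

/-- The one-sided step of §3 (p0005: "Write `g(−1−x) = g̃(−x−1) + b_t(−1)^{β_t+γ_t} x^{γ_t}
(x+1)^{β_t}` … `V(g(−1−x)) ≤ V(g̃(−x−1)(x+1)^{−β_t}) + 1` … and we may apply Proposition 7 to
`g̃(−x−1)(x+1)^{−β_t}` in order to get (i0)"), stated for an arbitrary honest family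
`P = Σᵢ dᵢ x^{μᵢ}(x+1)^{νᵢ}` (`dᵢ ≠ 0`, distinct `(μᵢ, νᵢ)`, `t = #ι ≥ 2`) possessing a term `i₀`
with `ν_{i₀} < νᵢ` and `μᵢ + νᵢ < μ_{i₀} + ν_{i₀}` for all `i ≠ i₀`: then `V(P) ≤ 2t − 3`, and
`V(P) = 2t − 3` forces a term `i₁ ≠ i₀` with `μ_{i₁} < μᵢ` and `μᵢ + νᵢ < μ_{i₁} + ν_{i₁}` for all
`i ∉ {i₀, i₁}` (the printed (i0), resp. (i1)).
[cite: BihanElhilany2017, §3 (proof of Thm. 1, (i0)/(i1)), arXiv:1506.03309 p0005–p0006] -/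
theorem signVariations_le_of_config (d : ι → K) (μ ν : ι → ℕ) (hd : ∀ i, d i ≠ 0)
    (hinj : Function.Injective fun i => (μ i, ν i)) (ht : 2 ≤ Fintype.card ι) {i₀ : ι}
    (hE : ∀ i, i ≠ i₀ → ν i₀ < ν i ∧ μ i + ν i < μ i₀ + ν i₀) :
    (∑ i, C (d i) * X ^ (μ i) * (X + C 1) ^ (ν i)).signVariations + 3 ≤ 2 * Fintype.card ι ∧
      ((∑ i, C (d i) * X ^ (μ i) * (X + C 1) ^ (ν i)).signVariations + 3 = 2 * Fintype.card ι →
        ∃ i₁, i₁ ≠ i₀ ∧ ∀ i, i ≠ i₁ → i ≠ i₀ → μ i₁ < μ i ∧ μ i + ν i < μ i₁ + ν i₁) := by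
  classical
  have hmle : ∀ i, ν i₀ ≤ ν i := fun i => by
    by_cases hi : i = i₀
    · rw [hi]
    · exact (hE i hi).1.le
  set P := ∑ i, C (d i) * X ^ (μ i) * (X + C 1) ^ (ν i) with hP_def
  set s := (Finset.univ : Finset ι).erase i₀ with hs_def
  -- `P = (x+1)^{ν₀} · (H̃ + d₀ x^{μ₀})`, `H̃` the family without its term `i₀`
  set Ht := ∑ i ∈ s, C (d i) * X ^ (μ i) * (X + C 1) ^ (ν i - ν i₀) with hHt_def
  have hPfac : P = (X + C 1) ^ (ν i₀) * (Ht + C (d i₀) * X ^ (μ i₀)) := by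
    rw [hP_def, hHt_def, ← Finset.sum_erase_add _ _ (Finset.mem_univ i₀), ← hs_def, mul_add,
      Finset.mul_sum]
    congr 1
    · refine Finset.sum_congr rfl fun i _ => ?_
      conv_lhs => rw [← Nat.add_sub_cancel' (hmle i), pow_add]
      ring
    · ring
  -- there is a second term, so `μ₀ ≥ 1`
  have hι2 : ∃ j, j ≠ i₀ := by
    by_contra hcon
    push Not at hcon
    have : Fintype.card ι ≤ 1 := Fintype.card_le_one_iff.mpr (fun a b => by rw [hcon a, hcon b])
    omega
  obtain ⟨j₁, hj₁⟩ := hι2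
  have hμ₀ : 1 ≤ μ i₀ := by
    have := hE j₁ hj₁
    omega
  have hHtnat : Ht.natDegree ≤ μ i₀ - 1 := by
    rw [hHt_def]
    refine natDegree_sum_le_of_forall_le _ _ fun i hi => ?_
    have h1 := hE i (Finset.ne_of_mem_erase hi)
    have h2 := hmle i
    calc (C (d i) * X ^ (μ i) * (X + C 1) ^ (ν i - ν i₀) : K[X]).natDegree
        ≤ (C (d i) * X ^ (μ i) : K[X]).natDegree + ((X + C 1 : K[X]) ^ (ν i - ν i₀)).natDegree :=
          natDegree_mul_le
      _ ≤ μ i + (ν i - ν i₀) := Nat.add_le_add (natDegree_C_mul_X_pow_le _ _)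
          (by rw [natDegree_pow, natDegree_X_add_C, mul_one])
      _ ≤ μ i₀ - 1 := by omega
  have hHtdeg : Ht.degree < (μ i₀ : ℕ) := by
    refine lt_of_le_of_lt degree_le_natDegree ?_
    exact_mod_cast (show Ht.natDegree < μ i₀ by omega)
  have hV1 : P.signVariations ≤ (Ht + C (d i₀) * X ^ (μ i₀)).signVariations := by
    rw [hPfac]; exact signVariations_X_add_C_pow_mul_le one_pos (ν i₀) _
  have hV2 : (Ht + C (d i₀) * X ^ (μ i₀)).signVariations ≤ Ht.signVariations + 1 := by
    rw [add_comm]; exact signVariations_C_mul_X_pow_add_le (hd i₀) hHtdeg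
  -- `H̃` as a family over the subtype `↥s`, `#s = t − 1`
  have hHt_fam : Ht = ∑ i : s, C (d i) * X ^ (μ i) * (X + C 1) ^ (ν i - ν i₀) := by
    rw [hHt_def]
    exact (Finset.sum_coe_sort s (fun i => C (d i) * X ^ (μ i) * (X + C 1) ^ (ν i - ν i₀))).symm
  have hcard_s : Fintype.card s = Fintype.card ι - 1 := by
    rw [Fintype.card_coe, hs_def, Finset.card_erase_of_mem (Finset.mem_univ _), Finset.card_univ]
  have hV3 : Ht.signVariations + 2 ≤ 2 * (Fintype.card ι - 1) := by
    rw [hHt_fam, ← hcard_s]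
    exact signVariations_family_add_two_le _ _ _ (by rw [hcard_s]; omega)
  refine ⟨by omega, fun htight => ?_⟩
  have hVt : (∑ i : s, C (d i) * X ^ (μ (i : ι)) * (X + C 1) ^ (ν (i : ι) - ν i₀)).signVariations
      + 2 = 2 * Fintype.card s := by
    rw [← hHt_fam, hcard_s]; omega
  have hd' : ∀ i : s, d i ≠ 0 := fun i => hd i
  have hinj' : Function.Injective fun i : s => (μ (i : ι), ν (i : ι) - ν i₀) := by
    intro a b hab
    simp only [Prod.mk.injEq] at hab
    apply Subtype.ext
    apply hinj
    simp only [Prod.mk.injEq]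
    refine ⟨hab.1, ?_⟩
    have := hmle a; have := hmle b; omega
  obtain ⟨j₀, hj₀⟩ := prop_7_family (fun i : s => d i) (fun i : s => μ i)
    (fun i : s => ν i - ν i₀) hd' hinj' hVt
  refine ⟨(j₀ : ι), Finset.ne_of_mem_erase j₀.2, fun i hi1 hi0 => ?_⟩
  have hi_s : i ∈ s := by rw [hs_def]; exact Finset.mem_erase.mpr ⟨hi0, Finset.mem_univ _⟩
  have := hj₀ ⟨i, hi_s⟩ (fun h => hi1 (congrArg Subtype.val h))
  have h1 := hmle i; have h2 := hmle (j₀ : ι)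
  simp only at this
  omega

/-- The heart of §3: for an honest family with `t ≥ 2` terms, `D ≥ αᵢ + βᵢ`, and
`V(g) = V_{I₁}(g) = 2t − 2`, one has `V_{I₂}(g) ≤ 2t − 3` and `V_{I₃}(g) ≤ 2t − 3` (here
`V_{I₂}(g) = V(g₂)`, `V_{I₃}(g) = V(g₃)` as in the section header), and — when `t ≥ 3`, which the
printed incompatibility argument "(i1) implies `γ_{i₀} + β_{i₀} < γᵢ + βᵢ` for all `i ≠ i₀`" needs
— `V_{I₂}(g) + V_{I₃}(g) < 2(2t − 3)`: "Consequently, if `V(g) = V_{I₁}(g) = 2t − 2`, then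
`V_{I₂}(g) ≤ 2t−3`, `V_{I₃}(g) ≤ 2t−3` and `V_{I₂}(g) + V_{I₃}(g) < 2(2t−3)`."
[cite: BihanElhilany2017, §3 (proof of Thm. 1, "Consequently …"), arXiv:1506.03309 p0006] -/
theorem signVariations_le_of_eq (c : ι → K) (α β : ι → ℕ) (hc : ∀ i, c i ≠ 0)
    (hinj : Function.Injective fun i => (α i, β i)) (ht : 2 ≤ Fintype.card ι) {D : ℕ}
    (hD : ∀ i, α i + β i ≤ D)
    (hV : (∑ i, C (c i) * X ^ (α i) * (X + C 1) ^ (β i)).signVariations + 2 =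
      2 * Fintype.card ι) :
    (∑ i, C (c i * (-1) ^ (α i + β i)) * X ^ (β i) * (X + C 1) ^ (α i)).signVariations + 3 ≤
        2 * Fintype.card ι ∧
      (∑ i, C (c i * (-1) ^ (D - (α i + β i) + β i)) * X ^ (β i) *
          (X + C 1) ^ (D - (α i + β i))).signVariations + 3 ≤ 2 * Fintype.card ι ∧
      (3 ≤ Fintype.card ι →
        (∑ i, C (c i * (-1) ^ (α i + β i)) * X ^ (β i) * (X + C 1) ^ (α i)).signVariations +
          (∑ i, C (c i * (-1) ^ (D - (α i + β i) + β i)) * X ^ (β i) *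
            (X + C 1) ^ (D - (α i + β i))).signVariations + 7 ≤ 4 * Fintype.card ι) := by
  classical
  obtain ⟨i₀, hE⟩ := prop_7_family c α β hc hinj hV
  have hs : ∀ n : ℕ, ((-1 : K)) ^ n ≠ 0 := fun n => pow_ne_zero _ (neg_ne_zero.mpr one_ne_zero)
  -- (1) the swapped family `g₂ = g(−1−x)`
  have h2 := signVariations_le_of_config (fun i => c i * (-1) ^ (α i + β i)) β α
    (fun i => mul_ne_zero (hc i) (hs _))
    (fun a b hab => hinj (by simp only [Prod.mk.injEq] at hab ⊢; exact ⟨hab.2, hab.1⟩)) ht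
    (i₀ := i₀) (fun i hi => by have := hE i hi; omega)
  -- (2) the reflected family `g₁ = x^D g(1/x)`, whose swap is `g₃`
  have h3 := signVariations_le_of_config (fun i => c i * (-1) ^ (D - (α i + β i) + β i)) β
    (fun i => D - (α i + β i)) (fun i => mul_ne_zero (hc i) (hs _))
    (fun a b hab => hinj (by
      simp only [Prod.mk.injEq] at hab ⊢
      have := hD a; have := hD b
      constructor <;> omega)) ht
    (i₀ := i₀) (fun i hi => by have := hE i hi; have := hD i; have := hD i₀; omega)
  refine ⟨h2.1, h3.1, fun ht3 => ?_⟩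
  by_contra hcon
  obtain ⟨i₁, hi₁, H1⟩ := h2.2 (by omega)
  obtain ⟨i₂, hi₂, H2⟩ := h3.2 (by omega)
  -- (i0) and (i1) name the same term: the strict minimum of `β` off `i₀`
  have h12 : i₁ = i₂ := by
    by_contra hne
    have a := (H1 i₂ (Ne.symm hne) hi₂).1
    have b := (H2 i₁ hne hi₁).1
    omega
  subst h12
  -- … and are incompatible at any third term
  have hthird : ∃ i, i ≠ i₁ ∧ i ≠ i₀ := by
    have hcard : (((Finset.univ : Finset ι).erase i₀).erase i₁).card = Fintype.card ι - 1 - 1 := by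
      rw [Finset.card_erase_of_mem (Finset.mem_erase.mpr ⟨hi₁, Finset.mem_univ _⟩),
        Finset.card_erase_of_mem (Finset.mem_univ _), Finset.card_univ]
    obtain ⟨i, hi⟩ := Finset.card_pos.mp (by rw [hcard]; omega)
    simp only [Finset.mem_erase, Finset.mem_univ, and_true] at hi
    exact ⟨i, hi.1, hi.2⟩
  obtain ⟨i, hi1, hi0⟩ := hthird
  have a := H1 i hi1 hi0
  have b := H2 i hi1 hi0
  have := hD i; have := hD i₁
  omega

end Config

section Counts

variable {K : Type*} [Field K] [LinearOrder K] [IsStrictOrderedRing K]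
variable {ι : Type*} [Fintype ι] (c : ι → K) (α β : ι → ℕ)

omit [LinearOrder K] [IsStrictOrderedRing K] in
/-- `deg (Σᵢ cᵢ x^{αᵢ}(x+1)^{βᵢ}) ≤ D` when `D ≥ αᵢ + βᵢ`. [folklore] -/
private theorem natDegree_family_le {D : ℕ} (hD : ∀ i, α i + β i ≤ D) :
    (∑ i, C (c i) * X ^ (α i) * (X + C 1) ^ (β i)).natDegree ≤ D := by
  refine natDegree_sum_le_of_forall_le _ _ fun i _ => ?_
  calc (C (c i) * X ^ (α i) * (X + C 1) ^ (β i) : K[X]).natDegree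
      ≤ (C (c i) * X ^ (α i) : K[X]).natDegree + ((X + C 1 : K[X]) ^ (β i)).natDegree :=
        natDegree_mul_le
    _ ≤ α i + β i := Nat.add_le_add (natDegree_C_mul_X_pow_le _ _)
        (by rw [natDegree_pow, natDegree_X_add_C, mul_one])
    _ ≤ D := hD i

/-- Roots in `(−∞, −1)` with multiplicity are at most `V_{I₂}(g) = V(g(−1−x))` (Descartes' rule
for `g(−1−x) = Σᵢ cᵢ(−1)^{αᵢ+βᵢ} x^{βᵢ}(x+1)^{αᵢ}`).
[cite: BihanElhilany2017, §3 (the counts V_{I_i}), arXiv:1506.03309 p0005] -/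
theorem countP_roots_lt_neg_one_le_signVariations :
    (∑ i, C (c i) * X ^ (α i) * (X + C 1) ^ (β i)).roots.countP (fun x => x < -1) ≤
      (∑ i, C (c i * (-1) ^ (α i + β i)) * X ^ (β i) * (X + C 1) ^ (α i)).signVariations := by
  classical
  set g := ∑ i, C (c i) * X ^ (α i) * (X + C 1) ^ (β i) with hg_def
  set g₂ := ∑ i, C (c i * (-1) ^ (α i + β i)) * X ^ (β i) * (X + C 1) ^ (α i) with hg₂_def
  have hcomp : g.comp (C (-1) * X + C (-1)) = g₂ := Avendano2009.comp_neg_X_sub_one c α β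
  have hroots : g₂.roots = g.roots.map (fun x => -1 - x) := by
    rw [← hcomp, roots_comp_C_mul_X_add_C g (-1) (-1) isUnit_one.neg, Ring.inverse_eq_inv]
    refine Multiset.map_congr rfl fun x _ => ?_
    field_simp
    ring
  have hcount : g₂.roots.countP (fun x => 0 < x) = g.roots.countP (fun x => x < -1) := by
    rw [hroots, Multiset.countP_map, Multiset.countP_eq_card_filter]
    congr 1
    exact Multiset.filter_congr fun x _ => by constructor <;> intro h <;> linarith
  rw [← hcount]
  exact roots_countP_pos_le_signVariations g₂

omit [Fintype ι] in
/-- `1/y < −1 ⟺ −1 < y < 0` (`y ≠ 0`). [folklore] -/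
private theorem inv_lt_neg_one_iff' {y : K} (hy : y ≠ 0) : y⁻¹ < -1 ↔ -1 < y ∧ y < 0 := by
  constructor
  · intro h
    have hyneg : y < 0 := by
      by_contra hcon
      have : 0 < y := lt_of_le_of_ne (not_lt.mp hcon) (Ne.symm hy)
      have : 0 < y⁻¹ := inv_pos.mpr this
      linarith
    refine ⟨?_, hyneg⟩
    have h1 : y * y⁻¹ = 1 := mul_inv_cancel₀ hy
    nlinarith
  · rintro ⟨h1, h2⟩
    have h3 : y * y⁻¹ = 1 := mul_inv_cancel₀ h2.ne
    have h4 : y⁻¹ < 0 := inv_lt_zero.mpr h2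
    nlinarith

/-- Roots in `(−1, 0)` with multiplicity are at most `V` of
`g₃ = (x^D g(1/x))(−1−x) = Σᵢ cᵢ(−1)^{(D−αᵢ−βᵢ)+βᵢ} x^{βᵢ}(x+1)^{D−αᵢ−βᵢ}` (`D ≥ αᵢ + βᵢ`):
`x ↦ 1/x` sends `(−1, 0)` onto `(−∞, −1)`; the printed `V_{I₃}(g) = V((x+1)^d g(−x/(x+1)))`
is this count by Lemma 8 (`V_{I₂}(g₁) = V_{I₃}(g)`).
[cite: BihanElhilany2017, §3 (the counts V_{I_i}; Lemma 8), arXiv:1506.03309 p0005] -/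
theorem countP_roots_Ioo_le_signVariations {D : ℕ} (hD : ∀ i, α i + β i ≤ D)
    (hg : ∑ i, C (c i) * X ^ (α i) * (X + C 1) ^ (β i) ≠ 0) :
    (∑ i, C (c i) * X ^ (α i) * (X + C 1) ^ (β i)).roots.countP (fun x => -1 < x ∧ x < 0) ≤
      (∑ i, C (c i * (-1) ^ (D - (α i + β i) + β i)) * X ^ (β i) *
        (X + C 1) ^ (D - (α i + β i))).signVariations := by
  classical
  set g := ∑ i, C (c i) * X ^ (α i) * (X + C 1) ^ (β i) with hg_def
  set h := ∑ i, C (c i) * X ^ (D - (α i + β i)) * (X + C 1) ^ (β i) with hh_def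
  have hrefl : g.reflect D = h := Avendano2009.reflect_eq c α β hD
  have hgdeg : g.natDegree ≤ D := natDegree_family_le c α β hD
  obtain ⟨e, he⟩ := Nat.exists_eq_add_of_le hgdeg
  have hrev : g.reflect D = g.reverse * X ^ e := by
    have := reflect_mul g 1 (F := g.natDegree) (G := e) le_rfl (by simp)
    rwa [mul_one, reflect_one, ← he] at this
  have hh0 : h ≠ 0 := by
    rw [← hrefl, hrev]
    exact mul_ne_zero (fun h0 => hg (reverse_eq_zero.mp h0)) (pow_ne_zero _ X_ne_zero)
  have h1 := countP_roots_lt_neg_one_le_signVariations c (fun i => D - (α i + β i)) β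
  have hroots : h.roots = ((g.roots.filter (· ≠ 0)).map (·⁻¹)) + e • ({0} : Multiset K) := by
    rw [← hrefl, hrev, roots_mul (hrev ▸ hrefl ▸ hh0),
      Literature.Algebra.Polynomial.Descartes.roots_reverse_of_ne_zero hg, roots_X_pow]
  have hcount : h.roots.countP (fun x => x < -1) = g.roots.countP (fun x => -1 < x ∧ x < 0) := by
    have h0 : Multiset.countP (fun x : K => x < -1) ({0} : Multiset K) = 0 :=
      Multiset.countP_eq_zero.mpr fun x hx => by
        rw [Multiset.mem_singleton] at hx; subst hx; norm_num
    rw [hroots, Multiset.countP_add, Multiset.countP_nsmul, h0, mul_zero, add_zero,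
      Multiset.countP_map, Multiset.filter_filter, Multiset.countP_eq_card_filter]
    congr 1
    refine Multiset.filter_congr fun x _ => ?_
    constructor
    · rintro ⟨hlt, hne⟩; exact (inv_lt_neg_one_iff' hne).mp hlt
    · rintro ⟨h1', h2'⟩; exact ⟨(inv_lt_neg_one_iff' h2'.ne).mpr ⟨h1', h2'⟩, h2'.ne⟩
  rw [← hcount, hh_def] at *
  exact h1

end Counts

section Symmetry

variable {K : Type*} [Field K] [LinearOrder K] [IsStrictOrderedRing K]
variable {ι : Type*} [Fintype ι] (c : ι → K) (α β : ι → ℕ)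

omit [LinearOrder K] [IsStrictOrderedRing K] in
/-- Signs only depend on the parity of the exponent. [folklore] -/
private theorem neg_one_pow_congr {m n : ℕ} (h : m % 2 = n % 2) : ((-1 : K)) ^ m = (-1) ^ n := by
  rw [neg_one_pow_eq_pow_mod_two, h, ← neg_one_pow_eq_pow_mod_two]

/-- `V(x^D h(1/x)) = V(h)` for a family `h = Σᵢ dᵢ x^{μᵢ}(x+1)^{νᵢ}`, `D ≥ μᵢ + νᵢ` ("On the
other hand `V(g) = V(g₁)`").
[cite: BihanElhilany2017, §3 (proof of Thm. 1), arXiv:1506.03309 p0006] -/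
theorem signVariations_family_reflect (d : ι → K) (μ ν : ι → ℕ) {D : ℕ}
    (hD : ∀ i, μ i + ν i ≤ D) :
    (∑ i, C (d i) * X ^ (D - (μ i + ν i)) * (X + C 1) ^ (ν i)).signVariations =
      (∑ i, C (d i) * X ^ (μ i) * (X + C 1) ^ (ν i)).signVariations := by
  rw [← Avendano2009.reflect_eq d μ ν hD, signVariations_reflect _ (natDegree_family_le d μ ν hD)]

omit [LinearOrder K] [IsStrictOrderedRing K] in
/-- `x ↦ −1 − x` is an involution on families: swapping twice returns `g`. [folklore] -/
private theorem swap_swap_eq :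
    ∑ i, C (c i * (-1) ^ (α i + β i) * (-1) ^ (β i + α i)) * X ^ (α i) * (X + C 1) ^ (β i) =
      ∑ i, C (c i) * X ^ (α i) * (X + C 1) ^ (β i) := by
  refine Finset.sum_congr rfl fun i _ => ?_
  rw [mul_assoc (c i), ← pow_add, neg_one_pow_congr (K := K) (n := 0) (by omega), pow_zero,
    mul_one]

/-- Lemma 8-type identity `V_{I₃}(h₃) = V_{I₃}(h)` in the reflected model: the `g₃` of the swapped
family is the reflection `x^D · (−)(1/x)` of `g₃`, so both have the same `V`.
[cite: BihanElhilany2017, Lemma 8, arXiv:1506.03309 p0005] -/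
theorem signVariations_swap_refl {D : ℕ} (hD : ∀ i, α i + β i ≤ D) :
    (∑ i, C (c i * (-1) ^ (α i + β i) * (-1) ^ (D - (β i + α i) + α i)) * X ^ (α i) *
        (X + C 1) ^ (D - (β i + α i))).signVariations =
      (∑ i, C (c i * (-1) ^ (D - (α i + β i) + β i)) * X ^ (β i) *
        (X + C 1) ^ (D - (α i + β i))).signVariations := by
  have hD' : ∀ i, β i + (D - (α i + β i)) ≤ D := fun i => by have := hD i; omega
  rw [← signVariations_family_reflect (fun i => c i * (-1) ^ (D - (α i + β i) + β i)) β
    (fun i => D - (α i + β i)) hD']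
  congr 1
  refine Finset.sum_congr rfl fun i _ => ?_
  have e1 : D - (β i + (D - (α i + β i))) = α i := by have := hD i; omega
  have e2 : D - (β i + α i) = D - (α i + β i) := by rw [add_comm]
  rw [e1, e2, mul_assoc (c i), ← pow_add,
    neg_one_pow_congr (K := K) (n := D - (α i + β i) + β i) (by have := hD i; omega)]

/-- Lemma 8-type identity in the reflected model: the swap `x ↦ −1 − x` of the family of `g₃`
is `x^D g(1/x)`, whose `V` is `V(g)`.
[cite: BihanElhilany2017, Lemma 8, arXiv:1506.03309 p0005] -/
theorem signVariations_fam3_swap {D : ℕ} (hD : ∀ i, α i + β i ≤ D) :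
    (∑ i, C (c i * (-1) ^ (D - (α i + β i) + β i) * (-1) ^ (β i + (D - (α i + β i)))) *
        X ^ (D - (α i + β i)) * (X + C 1) ^ (β i)).signVariations =
      (∑ i, C (c i) * X ^ (α i) * (X + C 1) ^ (β i)).signVariations := by
  rw [← signVariations_family_reflect c α β hD]
  congr 1
  refine Finset.sum_congr rfl fun i _ => ?_
  rw [mul_assoc (c i), ← pow_add, neg_one_pow_congr (K := K) (n := 0) (by omega), pow_zero,
    mul_one]

/-- Lemma 8-type identity in the reflected model: the `g₃` of the family of `g₃` reflects onto
`g₂ = g(−1−x)`, so both have the same `V`.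
[cite: BihanElhilany2017, Lemma 8, arXiv:1506.03309 p0005] -/
theorem signVariations_fam3_refl {D : ℕ} (hD : ∀ i, α i + β i ≤ D) :
    (∑ i, C (c i * (-1) ^ (D - (α i + β i) + β i) *
          (-1) ^ (D - (β i + (D - (α i + β i))) + (D - (α i + β i)))) *
        X ^ (D - (α i + β i)) * (X + C 1) ^ (D - (β i + (D - (α i + β i))))).signVariations =
      (∑ i, C (c i * (-1) ^ (α i + β i)) * X ^ (β i) * (X + C 1) ^ (α i)).signVariations := by
  have step : (∑ i, C (c i * (-1) ^ (D - (α i + β i) + β i) *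
          (-1) ^ (D - (β i + (D - (α i + β i))) + (D - (α i + β i)))) *
        X ^ (D - (α i + β i)) * (X + C 1) ^ (D - (β i + (D - (α i + β i))))) =
      ∑ i, C (c i * (-1) ^ (α i + β i)) * X ^ (D - (β i + α i)) * (X + C 1) ^ (α i) := by
    refine Finset.sum_congr rfl fun i _ => ?_
    have e1 : D - (β i + (D - (α i + β i))) = α i := by have := hD i; omega
    have e2 : D - (α i + β i) = D - (β i + α i) := by rw [add_comm]
    rw [e1, mul_assoc (c i), ← pow_add,
      neg_one_pow_congr (K := K) (n := α i + β i) (by have := hD i; omega), e2]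
  rw [step]
  exact signVariations_family_reflect (fun i => c i * (-1) ^ (α i + β i)) β α
    (fun i => by have := hD i; omega)

/-- **§3, display (E:toshow)**: for an honest family with `t ≥ 3` terms,
`V_{I₁}(g) + V_{I₂}(g) + V_{I₃}(g) ≤ 3(2t − 2) − 3 = 6t − 9`, by the case analysis of §3 made
symmetric through Lemma 8 (here: the previous three identities); for `t ≥ 2` the same analysis
gives `≤ 6t − 8` (at most one of the three counts equals `2t − 2`), a reading of the printed proof
not stated in print.
[cite: BihanElhilany2017, §3 (proof of Thm. 1, (E:toshow)), arXiv:1506.03309 p0005–p0006] -/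
theorem sum_signVariations_le (hc : ∀ i, c i ≠ 0) (hinj : Function.Injective fun i => (α i, β i))
    (ht : 2 ≤ Fintype.card ι) {D : ℕ} (hD : ∀ i, α i + β i ≤ D) :
    ((∑ i, C (c i) * X ^ (α i) * (X + C 1) ^ (β i)).signVariations +
        (∑ i, C (c i * (-1) ^ (α i + β i)) * X ^ (β i) * (X + C 1) ^ (α i)).signVariations +
        (∑ i, C (c i * (-1) ^ (D - (α i + β i) + β i)) * X ^ (β i) *
          (X + C 1) ^ (D - (α i + β i))).signVariations + 8 ≤ 6 * Fintype.card ι) ∧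
      (3 ≤ Fintype.card ι →
        (∑ i, C (c i) * X ^ (α i) * (X + C 1) ^ (β i)).signVariations +
        (∑ i, C (c i * (-1) ^ (α i + β i)) * X ^ (β i) * (X + C 1) ^ (α i)).signVariations +
        (∑ i, C (c i * (-1) ^ (D - (α i + β i) + β i)) * X ^ (β i) *
          (X + C 1) ^ (D - (α i + β i))).signVariations + 9 ≤ 6 * Fintype.card ι) := by
  classical
  have hs : ∀ n : ℕ, ((-1 : K)) ^ n ≠ 0 := fun n => pow_ne_zero _ (neg_ne_zero.mpr one_ne_zero)
  have b1 := signVariations_family_add_two_le c α β (by omega)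
  have b2 := signVariations_family_add_two_le (fun i => c i * (-1) ^ (α i + β i)) β α (by omega)
  have b3 := signVariations_family_add_two_le (fun i => c i * (-1) ^ (D - (α i + β i) + β i)) β
    (fun i => D - (α i + β i)) (by omega)
  by_cases h1 : (∑ i, C (c i) * X ^ (α i) * (X + C 1) ^ (β i)).signVariations + 2 =
      2 * Fintype.card ι
  · have A := signVariations_le_of_eq c α β hc hinj ht hD h1
    exact ⟨by omega, fun ht3 => by have := A.2.2 ht3; omega⟩
  by_cases h2 : (∑ i, C (c i * (-1) ^ (α i + β i)) * X ^ (β i) * (X + C 1) ^ (α i)).signVariations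
      + 2 = 2 * Fintype.card ι
  · -- `V_{I₂}(g) = 2t − 2`: run the argument on the swapped family (`g₂` in place of `g`)
    have hc' : ∀ i, c i * (-1) ^ (α i + β i) ≠ 0 := fun i => mul_ne_zero (hc i) (hs _)
    have hinj' : Function.Injective fun i => (β i, α i) := fun a b hab =>
      hinj (by simp only [Prod.mk.injEq] at hab ⊢; exact ⟨hab.2, hab.1⟩)
    have hD' : ∀ i, β i + α i ≤ D := fun i => by rw [add_comm]; exact hD i
    have A := signVariations_le_of_eq (fun i => c i * (-1) ^ (α i + β i)) β α hc' hinj' ht hD' h2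
    rw [swap_swap_eq c α β, signVariations_swap_refl c α β hD] at A
    exact ⟨by omega, fun ht3 => by have := A.2.2 ht3; omega⟩
  by_cases h3 : (∑ i, C (c i * (-1) ^ (D - (α i + β i) + β i)) * X ^ (β i) *
      (X + C 1) ^ (D - (α i + β i))).signVariations + 2 = 2 * Fintype.card ι
  · -- `V_{I₃}(g) = 2t − 2`: run the argument on the family of `g₃`
    have hc₃ : ∀ i, c i * (-1) ^ (D - (α i + β i) + β i) ≠ 0 := fun i => mul_ne_zero (hc i) (hs _)
    have hinj₃ : Function.Injective fun i => (β i, D - (α i + β i)) := fun a b hab =>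
      hinj (by
        simp only [Prod.mk.injEq] at hab ⊢
        have := hD a; have := hD b
        constructor <;> omega)
    have hD₃ : ∀ i, β i + (D - (α i + β i)) ≤ D := fun i => by have := hD i; omega
    have A := signVariations_le_of_eq (fun i => c i * (-1) ^ (D - (α i + β i) + β i)) β
      (fun i => D - (α i + β i)) hc₃ hinj₃ ht hD₃ h3
    rw [signVariations_fam3_swap c α β hD, signVariations_fam3_refl c α β hD] at A
    exact ⟨by omega, fun ht3 => by have := A.2.2 ht3; omega⟩
  exact ⟨by omega, fun _ => by omega⟩

end Symmetry

section Line

variable {K : Type*} [Field K] [LinearOrder K] [IsStrictOrderedRing K]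
variable {ι : Type*} [Fintype ι] (c : ι → K) (α β : ι → ℕ)

omit [Fintype ι] in
/-- An indicator is at most `1`. [folklore] -/
private theorem ite_le_one' (p : Prop) [Decidable p] : (if p then 1 else 0 : ℕ) ≤ 1 := by
  split_ifs <;> simp

omit [Fintype ι] in
/-- Splitting a count of the roots off `{0, −1}` into the three open intervals. [folklore] -/
private theorem countP_split' (m : Multiset K) :
    m.countP (fun x => x ≠ 0 ∧ x ≠ -1) =
      m.countP (fun x => x < -1) + m.countP (fun x => -1 < x ∧ x < 0) +
        m.countP (fun x => 0 < x) := by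
  induction m using Multiset.induction_on with
  | empty => simp
  | cons a m ih =>
    simp only [Multiset.countP_cons, ih]
    have key : (if a ≠ 0 ∧ a ≠ -1 then 1 else 0 : ℕ) =
        (if a < -1 then 1 else 0) + (if -1 < a ∧ a < 0 then 1 else 0) +
          (if 0 < a then 1 else 0) := by
      rcases lt_trichotomy a (-1) with h | h | h
      · have h1 : ¬ (-1 < a ∧ a < 0) := fun hh => by linarith [hh.1]
        have h2 : ¬ (0 < a) := fun hh => by linarith
        have h3 : a ≠ 0 ∧ a ≠ -1 := ⟨by intro h0; linarith, ne_of_lt h⟩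
        simp [h, h1, h2, h3]
      · subst h; simp
      · rcases lt_trichotomy a 0 with h' | h' | h'
        · have h1 : ¬ (a < -1) := fun hh => by linarith
          have h2 : ¬ (0 < a) := fun hh => by linarith
          have h3 : a ≠ 0 ∧ a ≠ -1 := ⟨ne_of_lt h', ne_of_gt h⟩
          simp [h, h1, h2, h3, h']
        · subst h'; simp
        · have h1 : ¬ (a < -1) := fun hh => by linarith
          have h2 : ¬ (-1 < a ∧ a < 0) := fun hh => by linarith [hh.2]
          have h3 : a ≠ 0 ∧ a ≠ -1 := ⟨ne_of_gt h', by intro h0; linarith⟩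
          simp [h1, h2, h3, h']
    omega

/-- **Theorem 1 on the line `y = x + 1`**, for an honest family with `t = #ι` terms,
`g = Σᵢ cᵢ x^{αᵢ}(x+1)^{βᵢ} ≠ 0`: the real roots counted with multiplicity, except that `0` and
`−1` are counted at most once, number at most `6t − 7` when `t ≥ 3` (the printed bound; written
`… + 7 ≤ 6t`) — and at most `6t − 6` when `t ≥ 2` (a consequence of the printed proof, not
stated in print; the printed `6t − 7` fails for `t = 2`, see `thm_1_asPrinted_counterexample`).
[cite: BihanElhilany2017, Thm. 1 (a = b = 1) and §3 (E:toshow), arXiv:1506.03309 p0003, p0005] -/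
theorem line_one_one (hc : ∀ i, c i ≠ 0) (hinj : Function.Injective fun i => (α i, β i))
    (ht : 2 ≤ Fintype.card ι) (hg : ∑ i, C (c i) * X ^ (α i) * (X + C 1) ^ (β i) ≠ 0) :
    ((∑ i, C (c i) * X ^ (α i) * (X + C 1) ^ (β i)).roots.countP (fun x => x ≠ 0 ∧ x ≠ -1) +
        (if (∑ i, C (c i) * X ^ (α i) * (X + C 1) ^ (β i)).IsRoot 0 then 1 else 0) +
        (if (∑ i, C (c i) * X ^ (α i) * (X + C 1) ^ (β i)).IsRoot (-1) then 1 else 0) + 6 ≤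
        6 * Fintype.card ι) ∧
      (3 ≤ Fintype.card ι →
        (∑ i, C (c i) * X ^ (α i) * (X + C 1) ^ (β i)).roots.countP (fun x => x ≠ 0 ∧ x ≠ -1) +
          (if (∑ i, C (c i) * X ^ (α i) * (X + C 1) ^ (β i)).IsRoot 0 then 1 else 0) +
          (if (∑ i, C (c i) * X ^ (α i) * (X + C 1) ^ (β i)).IsRoot (-1) then 1 else 0) + 7 ≤
          6 * Fintype.card ι) := by
  classical
  have hD : ∀ i, α i + β i ≤ ∑ i, (α i + β i) := fun i =>
    Finset.single_le_sum (f := fun i => α i + β i) (fun _ _ => Nat.zero_le _) (Finset.mem_univ i)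
  have h1 := roots_countP_pos_le_signVariations (∑ i, C (c i) * X ^ (α i) * (X + C 1) ^ (β i))
  have h2 := countP_roots_lt_neg_one_le_signVariations c α β
  have h3 := countP_roots_Ioo_le_signVariations c α β hD hg
  have hS := sum_signVariations_le c α β hc hinj ht hD
  rw [countP_split']
  have i1 := ite_le_one' ((∑ i, C (c i) * X ^ (α i) * (X + C 1) ^ (β i)).IsRoot 0)
  have i2 := ite_le_one' ((∑ i, C (c i) * X ^ (α i) * (X + C 1) ^ (β i)).IsRoot (-1))
  exact ⟨by omega, fun ht3 => by have := hS.2 ht3; omega⟩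

omit [LinearOrder K] [IsStrictOrderedRing K] [Fintype ι] in
/-- `g(s x) = 0 ⟺ g = 0` for `s ≠ 0`. [folklore] -/
private theorem comp_C_mul_X_eq_zero_iff' {s : K} (hs : s ≠ 0) (g : K[X]) :
    g.comp (C s * X) = 0 ↔ g = 0 := by
  constructor
  · intro h
    have hinv : (C s * X : K[X]).comp (C s⁻¹ * X) = X := by
      rw [mul_comp, C_comp, X_comp, ← mul_assoc, ← C_mul, mul_inv_cancel₀ hs, C_1, one_mul]
    rw [← comp_X (p := g), ← hinv, ← comp_assoc, h, zero_comp]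
  · intro h; rw [h, zero_comp]

/-- Theorem 1 on a general line, both thresholds at once (the printed reduction to `a = b = 1`
by `x ↦ (b/a)x`, and the sparse case `b = 0`).
[cite: BihanElhilany2017, Thm. 1 and §3 (first paragraph), arXiv:1506.03309 p0003, p0005] -/
theorem thm_1_aux (a b : K) (ha : a ≠ 0) (hc : ∀ i, c i ≠ 0)
    (hinj : Function.Injective fun i => (α i, β i)) (ht : 2 ≤ Fintype.card ι) :
    (∑ i, C (c i) * X ^ (α i) * (C a * X + C b) ^ (β i)) = 0 ∨
      ((∑ i, C (c i) * X ^ (α i) * (C a * X + C b) ^ (β i)).roots.countP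
            (fun x => x ≠ 0 ∧ x ≠ -b / a) +
          (if (∑ i, C (c i) * X ^ (α i) * (C a * X + C b) ^ (β i)).IsRoot 0 then 1 else 0) +
          (if (∑ i, C (c i) * X ^ (α i) * (C a * X + C b) ^ (β i)).IsRoot (-b / a) then 1 else 0)
          + 6 ≤ 6 * Fintype.card ι ∧
        (3 ≤ Fintype.card ι →
          (∑ i, C (c i) * X ^ (α i) * (C a * X + C b) ^ (β i)).roots.countP
              (fun x => x ≠ 0 ∧ x ≠ -b / a) +
            (if (∑ i, C (c i) * X ^ (α i) * (C a * X + C b) ^ (β i)).IsRoot 0 then 1 else 0) +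
            (if (∑ i, C (c i) * X ^ (α i) * (C a * X + C b) ^ (β i)).IsRoot (-b / a) then 1
              else 0) + 7 ≤ 6 * Fintype.card ι)) := by
  classical
  set g := ∑ i, C (c i) * X ^ (α i) * (C a * X + C b) ^ (β i) with hg_def
  by_cases hg : g = 0
  · exact Or.inl hg
  right
  have i1 := ite_le_one' (g.IsRoot 0)
  have i2 := ite_le_one' (g.IsRoot (-b / a))
  by_cases hb : b = 0
  · -- `b = 0`: `g = Σ cᵢ a^{βᵢ} x^{αᵢ + βᵢ}` is `t`-sparse and `−b/a = 0`
    have hb0 : -b / a = 0 := by rw [hb, neg_zero, zero_div]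
    have hgs : g = ∑ i, C (c i * a ^ (β i)) * X ^ (α i + β i) := by
      rw [hg_def]
      refine Finset.sum_congr rfl fun i _ => ?_
      rw [hb, C_0, add_zero, mul_pow, ← C_pow, C_mul, pow_add]; ring
    have hs := Avendano2009.sparse_case (fun i => c i * a ^ (β i)) (fun i => α i + β i) (hgs ▸ hg)
    rw [← hgs] at hs
    have hcnt : g.roots.countP (fun x => x ≠ 0 ∧ x ≠ -b / a) =
        g.roots.countP (fun x => x ≠ 0) := by
      rw [hb0]; exact Multiset.countP_congr rfl fun x _ => by simp
    rw [hcnt]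
    constructor
    · omega
    · intro _; omega
  · -- `a, b ≠ 0`: rescale to the line `y = x + 1`
    set s := b / a with hs_def
    have hs : s ≠ 0 := div_ne_zero hb ha
    set ĝ := ∑ i, C (c i * s ^ (α i) * b ^ (β i)) * X ^ (α i) * (X + C 1) ^ (β i) with hĝ_def
    have hcomp : g.comp (C s * X) = ĝ := Avendano2009.comp_C_mul_X_line c α β a b ha
    have hĝ : ĝ ≠ 0 := by
      rw [← hcomp]; exact fun h => hg ((comp_C_mul_X_eq_zero_iff' hs g).mp h)
    have hc' : ∀ i, c i * s ^ (α i) * b ^ (β i) ≠ 0 := fun i =>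
      mul_ne_zero (mul_ne_zero (hc i) (pow_ne_zero _ hs)) (pow_ne_zero _ hb)
    have h11 := line_one_one (fun i => c i * s ^ (α i) * b ^ (β i)) α β hc' hinj ht hĝ
    have hroots : ĝ.roots = g.roots.map (fun x => s⁻¹ * x) := by
      rw [← hcomp, show (C s * X : K[X]) = C s * X + C 0 by rw [C_0, add_zero],
        roots_comp_C_mul_X_add_C g s 0 (isUnit_iff_ne_zero.mpr hs), Ring.inverse_eq_inv]
      simp
    have hba : -b / a = -s := by rw [hs_def, neg_div]
    have hcount : ĝ.roots.countP (fun x => x ≠ 0 ∧ x ≠ -1) =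
        g.roots.countP (fun x => x ≠ 0 ∧ x ≠ -b / a) := by
      rw [hroots, Multiset.countP_map, Multiset.countP_eq_card_filter, hba]
      congr 1
      refine Multiset.filter_congr fun x _ => ?_
      have e1 : s⁻¹ * x = 0 ↔ x = 0 := by
        rw [mul_eq_zero, or_iff_right (inv_ne_zero hs)]
      have e2 : s⁻¹ * x = -1 ↔ x = -s := by
        constructor
        · intro h; have := congr_arg (s * ·) h; simp [hs] at this; linarith
        · intro h; rw [h, mul_neg, inv_mul_cancel₀ hs]
      rw [Ne, e1, Ne, e2]
    have hr0 : ĝ.IsRoot 0 ↔ g.IsRoot 0 := by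
      rw [← hcomp, IsRoot, eval_comp]; simp [IsRoot]
    have hr1 : ĝ.IsRoot (-1) ↔ g.IsRoot (-b / a) := by
      rw [← hcomp, IsRoot, eval_comp, hba]; simp [IsRoot]
    rw [hcount, if_congr hr0 rfl rfl, if_congr hr1 rfl rfl] at h11
    exact h11

/-- **Bihan–El Hilany 2017, Theorem 1**: "Let `f ∈ ℝ[x, y]` be a polynomial with at most `t`
non-zero terms and let `a, b` be any real numbers. Assume that the polynomial `g(x) = f(x, ax+b)`
is not identically zero. Then `g` has at most `6t − 7` real roots counted with multiplicities
except for the possible roots `0` and `−b/a` that are counted at most once."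
TYPED vs PRINTED. (1) **The binder `3 ≤ t` is explicit and necessary**: the printed statement
(the arXiv text of the theorem even reads "at most three non-zero terms" [sic], and writes
"`−a/b`") is false for `t = 1` (bound `−1`) and for `t = 2` (`thm_1_asPrinted_counterexample`:
`f = 625x³y³ − 36xy` meets `y = x + 1` in six real points, `> 6·2 − 7`); the printed proof uses a
third term in its last step ("(i1) implies `γ_{i₀}+β_{i₀} < γᵢ+βᵢ` for all `i ≠ i₀`, which
contradicts (i0)"). (2) The `t` terms are an indexed family `cᵢ x^{αᵢ} y^{βᵢ}` with `cᵢ ≠ 0`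
and distinct exponent pairs, so that `t = #ι` IS the number of non-zero terms (for `f` given as
an element of `K[x][y]` see `thm_1_of_bivariate`); `g = Σᵢ cᵢ x^{αᵢ}(ax+b)^{βᵢ}`; the count is
`#{roots ∉ {0, −b/a}, with multiplicity} + [g(0) = 0] + [g(−b/a) = 0]`, written `≤ 6t − 7`;
binder `a ≠ 0` explicit (the printed `−b/a` needs it; for `a = 0` the parent's
`Avendano2009.thm_1_of_a_eq_zero` gives `2t − 1 ≤ 6t − 7`). (3) Any linearly ordered field `K`
(the paper: `ℝ`). (4) `V_{I₃}` is computed through `x ↦ 1/x` (reflection) rather than the printed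
`(x+1)^d g(−x/(x+1))` (same counts by Lemma 8). Theorem 2 (optimality for `t = 3`, eleven points,
via real dessins d'enfants) is NOT typed.
[cite: BihanElhilany2017, Thm. 1, arXiv:1506.03309 p0003 L6–8; proof §3, p0005–p0006] -/
theorem thm_1 (a b : K) (ha : a ≠ 0) (hc : ∀ i, c i ≠ 0)
    (hinj : Function.Injective fun i => (α i, β i)) (ht : 3 ≤ Fintype.card ι) :
    (∑ i, C (c i) * X ^ (α i) * (C a * X + C b) ^ (β i)) = 0 ∨
      (∑ i, C (c i) * X ^ (α i) * (C a * X + C b) ^ (β i)).roots.countP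
          (fun x => x ≠ 0 ∧ x ≠ -b / a) +
        (if (∑ i, C (c i) * X ^ (α i) * (C a * X + C b) ^ (β i)).IsRoot 0 then 1 else 0) +
        (if (∑ i, C (c i) * X ^ (α i) * (C a * X + C b) ^ (β i)).IsRoot (-b / a) then 1 else 0)
        ≤ 6 * Fintype.card ι - 7 := by
  rcases thm_1_aux c α β a b ha hc hinj (by omega) with h | h
  · exact Or.inl h
  · right; have := h.2 ht; omega

/-- Theorem 1 for `t ≥ 2` with the bound `6t − 6` (what the printed argument yields for two or
more terms: at most one of `V_{I₁}, V_{I₂}, V_{I₃}` equals `2t − 2`); sharp for `t = 2` by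
`thm_1_asPrinted_counterexample`. A consequence of the printed proof, not a printed statement.
[cite: BihanElhilany2017, §3 (proof of Thm. 1), arXiv:1506.03309 p0005–p0006] -/
theorem thm_1_two_le (a b : K) (ha : a ≠ 0) (hc : ∀ i, c i ≠ 0)
    (hinj : Function.Injective fun i => (α i, β i)) (ht : 2 ≤ Fintype.card ι) :
    (∑ i, C (c i) * X ^ (α i) * (C a * X + C b) ^ (β i)) = 0 ∨
      (∑ i, C (c i) * X ^ (α i) * (C a * X + C b) ^ (β i)).roots.countP
          (fun x => x ≠ 0 ∧ x ≠ -b / a) +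
        (if (∑ i, C (c i) * X ^ (α i) * (C a * X + C b) ^ (β i)).IsRoot 0 then 1 else 0) +
        (if (∑ i, C (c i) * X ^ (α i) * (C a * X + C b) ^ (β i)).IsRoot (-b / a) then 1 else 0)
        ≤ 6 * Fintype.card ι - 6 := by
  rcases thm_1_aux c α β a b ha hc hinj ht with h | h
  · exact Or.inl h
  · right; omega

/-- **Theorem 1 for `f ∈ K[x][y]`** with `t` non-zero terms read off `f` (`t = Σⱼ #supp aⱼ` for
`f = Σⱼ aⱼ(x) yʲ`, the true number of terms), `t ≥ 3`, `a ≠ 0`: `g = f(x, ax + b)` is `0`, or its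
roots off `{0, −b/a}` counted with multiplicity plus `[g(0) = 0] + [g(−b/a) = 0]` number at most
`6t − 7`. [cite: BihanElhilany2017, Thm. 1, arXiv:1506.03309 p0003 L6–8] -/
theorem thm_1_of_bivariate (f : Polynomial (Polynomial K)) (a b : K) (ha : a ≠ 0)
    (ht : 3 ≤ ∑ j ∈ f.support, (f.coeff j).support.card) :
    f.eval (C a * X + C b) = 0 ∨
      (f.eval (C a * X + C b)).roots.countP (fun x => x ≠ 0 ∧ x ≠ -b / a) +
        (if (f.eval (C a * X + C b)).IsRoot 0 then 1 else 0) +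
        (if (f.eval (C a * X + C b)).IsRoot (-b / a) then 1 else 0)
        ≤ 6 * (∑ j ∈ f.support, (f.coeff j).support.card) - 7 := by
  classical
  rw [Avendano2009.eval_eq_sum_terms, ← Avendano2009.card_terms] at *
  refine thm_1 _ _ _ a b ha (fun i => mem_support_iff.mp i.2.2) ?_ ht
  rintro ⟨j, k⟩ ⟨j', k'⟩ h
  simp only [Prod.mk.injEq] at h
  obtain ⟨hk, hj⟩ := h
  obtain rfl : j = j' := Subtype.ext hj
  obtain rfl : k = k' := Subtype.ext hk
  rfl

/-- **The printed Theorem 1 fails for `t = 2`** (so the binder `3 ≤ t` of `thm_1` is needed):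
`f = 625 x³y³ − 36 xy` (two non-zero terms, distinct exponent pairs) and the line `y = x + 1`
(`a = b = 1`) give `g = x(x+1)(625x²(x+1)² − 36) = x(x+1)(5x−1)(5x+6)(5x+2)(5x+3)`, which is not
zero and has the six simple roots `0, −1, 1/5, −6/5, −2/5, −3/5`: the printed count is
`4 + 1 + 1 = 6 > 6·2 − 7 = 5`. Any linearly ordered field.
[cite: BihanElhilany2017, Thm. 1, arXiv:1506.03309 p0003 L6–8 (counterexample to the case t = 2)] -/
theorem thm_1_asPrinted_counterexample :
    let c : Fin 2 → K := ![625, -36]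
    let α : Fin 2 → ℕ := ![3, 1]
    let β : Fin 2 → ℕ := ![3, 1]
    (∀ i, c i ≠ 0) ∧ (Function.Injective fun i => (α i, β i)) ∧ Fintype.card (Fin 2) = 2 ∧
      (∑ i, C (c i) * X ^ (α i) * (C 1 * X + C 1) ^ (β i)) ≠ 0 ∧
      6 * Fintype.card (Fin 2) - 7 <
        (∑ i, C (c i) * X ^ (α i) * (C 1 * X + C 1) ^ (β i)).roots.countP
            (fun x => x ≠ 0 ∧ x ≠ -1 / 1) +
          (if (∑ i, C (c i) * X ^ (α i) * (C 1 * X + C 1) ^ (β i)).IsRoot 0 then 1 else 0) +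
          (if (∑ i, C (c i) * X ^ (α i) * (C 1 * X + C 1) ^ (β i)).IsRoot (-1 / 1) then 1
            else 0) := by
  intro c α β
  have hg : ∑ i, C (c i) * X ^ (α i) * (C 1 * X + C 1) ^ (β i) =
      C 625 * X ^ 3 * (X + C 1) ^ 3 + C (-36) * X * (X + C 1) := by
    simp [c, α, β, Fin.sum_univ_two]
  have heval : ∀ x : K, (∑ i, C (c i) * X ^ (α i) * (C 1 * X + C 1) ^ (β i)).eval x =
      625 * x ^ 3 * (x + 1) ^ 3 + (-36) * x * (x + 1) := by
    intro x; rw [hg]; simp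
  refine ⟨?_, ?_, rfl, ?_, ?_⟩
  · intro i; fin_cases i <;> simp [c]
  · intro i j h
    fin_cases i <;> fin_cases j <;> simp_all [α, β]
  · intro h0
    have := heval 1
    rw [h0, eval_zero] at this
    norm_num at this
  · have hr0 : (∑ i, C (c i) * X ^ (α i) * (C 1 * X + C 1) ^ (β i)).IsRoot 0 := by
      rw [IsRoot, heval]; norm_num
    have hr1 : (∑ i, C (c i) * X ^ (α i) * (C 1 * X + C 1) ^ (β i)).IsRoot (-1 / 1) := by
      rw [IsRoot, heval]; norm_num
    rw [if_pos hr0, if_pos hr1]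
    have hne : ∑ i, C (c i) * X ^ (α i) * (C 1 * X + C 1) ^ (β i) ≠ 0 := by
      intro h0
      have := heval 1
      rw [h0, eval_zero] at this
      norm_num at this
    -- the four roots off `{0, −1}`
    have hmem : ∀ r : K, 625 * r ^ 3 * (r + 1) ^ 3 + (-36) * r * (r + 1) = 0 →
        r ∈ (∑ i, C (c i) * X ^ (α i) * (C 1 * X + C 1) ^ (β i)).roots := by
      intro r hr
      rw [mem_roots hne, IsRoot, heval]
      exact hr
    have hsub : ({1 / 5, -6 / 5, -2 / 5, -3 / 5} : Multiset K) ≤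
        (∑ i, C (c i) * X ^ (α i) * (C 1 * X + C 1) ^ (β i)).roots := by
      refine (Multiset.le_iff_subset ?_).mpr ?_
      · simp only [Multiset.insert_eq_cons, Multiset.nodup_cons, Multiset.mem_cons,
          Multiset.mem_singleton, Multiset.nodup_singleton]
        norm_num
      · intro r hr
        simp only [Multiset.insert_eq_cons, Multiset.mem_cons, Multiset.mem_singleton] at hr
        rcases hr with rfl | rfl | rfl | rfl <;> exact hmem _ (by norm_num)
    have hcount := Multiset.countP_le_of_le (p := fun x : K => x ≠ 0 ∧ x ≠ -1 / 1) hsub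
    have h4 : Multiset.countP (fun x : K => x ≠ 0 ∧ x ≠ -1 / 1)
        ({1 / 5, -6 / 5, -2 / 5, -3 / 5} : Multiset K) = 4 := by
      rw [Multiset.countP_eq_card.mpr]
      · rfl
      · intro r hr
        simp only [Multiset.insert_eq_cons, Multiset.mem_cons, Multiset.mem_singleton] at hr
        rcases hr with rfl | rfl | rfl | rfl <;> norm_num
    rw [h4] at hcount
    simp only [Fintype.card_fin]
    omega

omit [Field K] [LinearOrder K] [IsStrictOrderedRing K] [Fintype ι] in
/-- Distinct elements of a multiset versus a count with multiplicity off two marked points.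
[folklore] -/
private theorem card_toFinset_le_countP_add' [DecidableEq K] (m : Multiset K) (e₁ e₂ : K) :
    m.toFinset.card ≤ m.countP (fun x => x ≠ e₁ ∧ x ≠ e₂) +
      (if e₁ ∈ m then 1 else 0) + (if e₂ ∈ m then 1 else 0) := by
  rw [← Finset.card_filter_add_card_filter_not (fun x => x ≠ e₁ ∧ x ≠ e₂)]
  have h1 : (m.toFinset.filter (fun x => x ≠ e₁ ∧ x ≠ e₂)).card ≤
      m.countP (fun x => x ≠ e₁ ∧ x ≠ e₂) := by
    rw [← Multiset.toFinset_filter, Multiset.countP_eq_card_filter]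
    exact Multiset.toFinset_card_le _
  have h2 : (m.toFinset.filter (fun x => ¬ (x ≠ e₁ ∧ x ≠ e₂))).card ≤
      (if e₁ ∈ m then 1 else 0) + (if e₂ ∈ m then 1 else 0) := by
    have hsub : m.toFinset.filter (fun x => ¬ (x ≠ e₁ ∧ x ≠ e₂)) ⊆
        m.toFinset.filter (fun x => x = e₁) ∪ m.toFinset.filter (fun x => x = e₂) := by
      intro x hx
      rw [Finset.mem_filter] at hx
      rw [Finset.mem_union, Finset.mem_filter, Finset.mem_filter]
      by_cases hx1 : x = e₁
      · exact Or.inl ⟨hx.1, hx1⟩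
      · right; refine ⟨hx.1, ?_⟩
        by_contra hx2; exact hx.2 ⟨hx1, hx2⟩
    refine (Finset.card_le_card hsub).trans ((Finset.card_union_le _ _).trans ?_)
    rw [Finset.filter_eq', Finset.filter_eq']
    simp only [Multiset.mem_toFinset]
    split_ifs <;> simp
  omega

/-- **Theorem 1, distinct-roots form** (typed ⊊ printed: every root counted once): for an honest
family with `t ≥ 3` terms, on ANY line `y = ax + b` (`a = 0` included: there `g` is `t`-sparse with
at most `2t − 1` distinct roots, by the parent's `Avendano2009.thm_1_of_a_eq_zero`), if
`g = f(x, ax+b) ≠ 0` then `g` has at most `6t − 7` distinct roots in `K`.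
[cite: BihanElhilany2017, Thm. 1 (corollary: distinct roots), arXiv:1506.03309 p0003 L6–8] -/
theorem thm_1_card_roots_le (a b : K) (hc : ∀ i, c i ≠ 0)
    (hinj : Function.Injective fun i => (α i, β i)) (ht : 3 ≤ Fintype.card ι)
    (hg : ∑ i, C (c i) * X ^ (α i) * (C a * X + C b) ^ (β i) ≠ 0) :
    (∑ i, C (c i) * X ^ (α i) * (C a * X + C b) ^ (β i)).roots.toFinset.card ≤
      6 * Fintype.card ι - 7 := by
  classical
  have hmem : ∀ e, (if e ∈ (∑ i, C (c i) * X ^ (α i) * (C a * X + C b) ^ (β i)).roots then 1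
      else 0) = (if (∑ i, C (c i) * X ^ (α i) * (C a * X + C b) ^ (β i)).IsRoot e then 1
      else 0 : ℕ) := fun e => if_congr (mem_roots hg) rfl rfl
  by_cases ha : a = 0
  · subst ha
    rcases Avendano2009.thm_1_of_a_eq_zero c α β b with h0 | h
    · exact absurd h0 hg
    have hcard := card_toFinset_le_countP_add'
      (∑ i, C (c i) * X ^ (α i) * (C 0 * X + C b) ^ (β i)).roots 0 0
    rw [hmem] at hcard
    have hcc : (∑ i, C (c i) * X ^ (α i) * (C 0 * X + C b) ^ (β i)).roots.countP
        (fun x => x ≠ 0 ∧ x ≠ 0) =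
        (∑ i, C (c i) * X ^ (α i) * (C 0 * X + C b) ^ (β i)).roots.countP (fun x => x ≠ 0) :=
      Multiset.countP_congr rfl fun x _ => by simp
    rw [hcc] at hcard
    have i1 := ite_le_one' ((∑ i, C (c i) * X ^ (α i) * (C 0 * X + C b) ^ (β i)).IsRoot 0)
    omega
  · rcases thm_1 c α β a b ha hc hinj ht with h0 | h
    · exact absurd h0 hg
    have hcard := card_toFinset_le_countP_add'
      (∑ i, C (c i) * X ^ (α i) * (C a * X + C b) ^ (β i)).roots 0 (-b / a)
    rw [hmem, hmem] at hcard
    omega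

/-- Theorem 1, distinct-roots form, for `f ∈ K[x][y]` with `t ≥ 3` non-zero terms read off `f`:
on any line, `g = f(x, ax + b) ≠ 0` has at most `6t − 7` distinct roots.
[cite: BihanElhilany2017, Thm. 1 (corollary: distinct roots), arXiv:1506.03309 p0003 L6–8] -/
theorem thm_1_card_roots_le_of_bivariate (f : Polynomial (Polynomial K)) (a b : K)
    (ht : 3 ≤ ∑ j ∈ f.support, (f.coeff j).support.card) (hg : f.eval (C a * X + C b) ≠ 0) :
    (f.eval (C a * X + C b)).roots.toFinset.card ≤
      6 * (∑ j ∈ f.support, (f.coeff j).support.card) - 7 := by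
  classical
  rw [Avendano2009.eval_eq_sum_terms] at hg ⊢
  rw [← Avendano2009.card_terms] at ht ⊢
  refine thm_1_card_roots_le _ _ _ a b (fun i => mem_support_iff.mp i.2.2) ?_ ht hg
  rintro ⟨j, k⟩ ⟨j', k'⟩ h
  simp only [Prod.mk.injEq] at h
  obtain ⟨hk, hj⟩ := h
  obtain rfl : j = j' := Subtype.ext hj
  obtain rfl : k = k' := Subtype.ext hk
  rfl

omit [LinearOrder K] [IsStrictOrderedRing K] in
/-- A term family `cᵢ x^{αᵢ} y^{βᵢ}` (repetitions and zero coefficients allowed) as the bivariate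
polynomial `F = Σᵢ (cᵢ x^{αᵢ}) y^{βᵢ} ∈ K[x][y]`: restriction to a curve `y = q(x)`. [folklore] -/
private theorem eval_family_eq (q : K[X]) :
    ((∑ i, monomial (β i) (C (c i) * X ^ (α i)) : Polynomial (Polynomial K)).eval q) =
      ∑ i, C (c i) * X ^ (α i) * q ^ (β i) := by
  rw [eval_finsetSum]
  refine Finset.sum_congr rfl fun i _ => ?_
  rw [eval_monomial]

omit [LinearOrder K] [IsStrictOrderedRing K] in
/-- … its number of non-zero terms is at most `#ι`. [folklore] -/
private theorem card_terms_family_le :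
    ∑ j ∈ ((∑ i, monomial (β i) (C (c i) * X ^ (α i)) : Polynomial (Polynomial K))).support,
      (((∑ i, monomial (β i) (C (c i) * X ^ (α i)) :
        Polynomial (Polynomial K))).coeff j).support.card ≤ Fintype.card ι := by
  classical
  set F : Polynomial (Polynomial K) := ∑ i, monomial (β i) (C (c i) * X ^ (α i)) with hF_def
  have hsub : ∀ j, (F.coeff j).support ⊆ (Finset.univ.filter (fun i => β i = j)).image α := by
    intro j k hk
    rw [mem_support_iff, hF_def, coeff_coeff_family] at hk
    obtain ⟨i, _, hi⟩ := Finset.exists_ne_zero_of_sum_ne_zero hk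
    rw [Finset.mem_image]
    refine ⟨i, ?_, ?_⟩
    · rw [Finset.mem_filter]
      exact ⟨Finset.mem_univ _, (by by_contra h; exact hi (if_neg fun hh => h hh.1))⟩
    · by_contra h; exact hi (if_neg fun hh => h hh.2)
  calc ∑ j ∈ F.support, (F.coeff j).support.card
      ≤ ∑ j ∈ F.support, (Finset.univ.filter (fun i => β i = j)).card :=
        Finset.sum_le_sum fun j _ => (Finset.card_le_card (hsub j)).trans Finset.card_image_le
    _ = (Finset.univ.filter (fun i => β i ∈ F.support)).card :=
        Finset.sum_card_fiberwise_eq_card_filter _ _ _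
    _ ≤ Fintype.card ι := Finset.card_le_univ _

omit [Fintype ι] in
/-- **Theorem 1 in the printed "at most `t` non-zero terms" form**, for `f ∈ K[x][y]`: if `f` has at
most `t` non-zero terms, `t ≥ 3`, and `a ≠ 0`, then `g = f(x, ax + b)` is `0` or the printed count
is at most `6t − 7` (for fewer than `3` actual terms the parent's `6T − 4 ≤ 8 ≤ 6t − 7` takes over).
[cite: BihanElhilany2017, Thm. 1, arXiv:1506.03309 p0003 L6–8] -/
theorem thm_1_of_bivariate_atMost (f : Polynomial (Polynomial K)) (a b : K) (ha : a ≠ 0) {t : ℕ}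
    (ht : 3 ≤ t) (hT : ∑ j ∈ f.support, (f.coeff j).support.card ≤ t) :
    f.eval (C a * X + C b) = 0 ∨
      (f.eval (C a * X + C b)).roots.countP (fun x => x ≠ 0 ∧ x ≠ -b / a) +
        (if (f.eval (C a * X + C b)).IsRoot 0 then 1 else 0) +
        (if (f.eval (C a * X + C b)).IsRoot (-b / a) then 1 else 0) ≤ 6 * t - 7 := by
  by_cases h3 : 3 ≤ ∑ j ∈ f.support, (f.coeff j).support.card
  · rcases thm_1_of_bivariate f a b ha h3 with h | h
    · exact Or.inl h
    · right; omega
  · rcases Avendano2009.thm_1_of_bivariate f a b ha with h | h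
    · exact Or.inl h
    · right; omega

/-- **Theorem 1 for an arbitrary term family** (repetitions of exponent pairs and zero
coefficients allowed — exactly the parent's `Avendano2009.thm_1` setting, "a polynomial with at
most `t` non-zero terms"): if `#ι ≤ t`, `t ≥ 3`, `a ≠ 0`, then `g = Σᵢ cᵢ x^{αᵢ}(ax+b)^{βᵢ}` is `0`
or the printed count is at most `6t − 7`.
[cite: BihanElhilany2017, Thm. 1, arXiv:1506.03309 p0003 L6–8] -/
theorem thm_1_atMost (a b : K) (ha : a ≠ 0) {t : ℕ} (ht : 3 ≤ t) (hι : Fintype.card ι ≤ t) :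
    (∑ i, C (c i) * X ^ (α i) * (C a * X + C b) ^ (β i)) = 0 ∨
      (∑ i, C (c i) * X ^ (α i) * (C a * X + C b) ^ (β i)).roots.countP
          (fun x => x ≠ 0 ∧ x ≠ -b / a) +
        (if (∑ i, C (c i) * X ^ (α i) * (C a * X + C b) ^ (β i)).IsRoot 0 then 1 else 0) +
        (if (∑ i, C (c i) * X ^ (α i) * (C a * X + C b) ^ (β i)).IsRoot (-b / a) then 1 else 0)
        ≤ 6 * t - 7 := by
  rw [← eval_family_eq c α β (C a * X + C b)]
  exact thm_1_of_bivariate_atMost _ a b ha ht ((card_terms_family_le c α β).trans hι)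

end Line

end BihanElHilany2017

end Literature.Algebra.Polynomial

end
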